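import Literature.AlgebraicGeometry.HodgeTheory.GAGALocalEquation
import Literature.AlgebraicGeometry.HodgeTheory.AnalytificationCartierDivisor
import Literature.AlgebraicGeometry.HodgeTheory.AlgebraicityLocusLinearSections
import Literature.AlgebraicGeometry.Resolution.LinearSectionsChoice
import Literature.AlgebraicGeometry.Resolution.LinearSectionsLocalDim
import Literature.AlgebraicGeometry.Resolution.RegularLocalRingsProofs
import Literature.Topology.KrullDimZero
import Literature.AlgebraicGeometry.Motives.VarietiesRegularProofs
import HarnessLib

/-!
# A transverse pencil of hyperplane sections on a smooth projective surface, read on the analytification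

Family `hodge`, layer `Literature/AlgebraicGeometry/HodgeTheory`. Support for Serre's Théorème A
for the sheaf of sections of a holomorphic line cocycle on a smooth projective surface
(`serre_theoremA_lineCocycle_surface`, `SerreTheoremALineBundles.lean`), in the
Euler-characteristic form of J.-P. Serre, *Faisceaux algébriques cohérents* (1955) n° 66, 81 and
*GAGA* (1956) n° 16 Lemme 8: the dimension count runs along a smooth hyperplane section
`C = X ∩ V(ℓ)` and a second hyperplane `V(ℓ')` meeting `C` transversally, both supplied by
Bertini's theorem (Hartshorne II 8.18) on the algebraic side, and READ ON THE ANALYTIFICATION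
`φ : M → X(ℂ)` through Serre's principle that at a simple point the algebraic local equations are
analytic local coordinates (GAGA §1 n° 4, §2 n° 6 Cor. 2). This file proves:

* `GAGADimension.notMem_sq_of_isRegularLocalRing_quotient` — in a regular local ring, a non-zero
  `x ∈ 𝔪` with `R/(x)` regular lies outside `𝔪²` (Matsumura Thm. 14.2);
* `surjective_pi_mfderiv_evalOrZero_comp` — **independent algebraic differentials are independent
  analytic differentials**: for `X` smooth projective of dimension `n` over `ℂ`, an analytification
  `φ : M → X(ℂ)` (holomorphic atlas on `M`), an affine open `U`, a point `m` with `φ m ∈ U(ℂ)` and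
  regular functions `g₁, …, g_c ∈ Γ(X, U)` vanishing at `φ m` and linearly independent modulo
  `𝔪_{φ m}²`, the differentials at `m` of the holomorphic functions `gⱼ ∘ φ` are jointly onto `ℂᶜ`
  (computed in the algebraic-chart model of `X^h`, `GAGADimension.surjective_pi_fderiv_chart`, and
  moved to `M` by the uniqueness of the analytification, `IsAnalytification.unique_holds`, exactly
  as in `exists_chart_mfderiv_ne_zero`); corollaries
  `mfderiv_evalOrZero_comp_ne_zero_of_isRegularLocalRing_quotient` (`𝒪_{X,φ m}/(g)` regular,
  `g ≠ 0` ⟹ `d(g ∘ φ)(m) ≠ 0`) and `surjective_pi_mfderiv_evalOrZero_comp_of_span_eq_maximalIdeal`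
  (`(g₁, …, gₙ)_x = 𝔪_x`, `n = dim X` ⟹ the `gⱼ ∘ φ` are holomorphic local coordinates at `m`);
* `exists_linForms_transverse` — **Bertini twice on a smooth projective surface `X ↪ ℙᴺ`**:
  linear forms `t₀, t₁` with `t₀ ∉ I(X)`, `𝒪_{X,x}/(t₀)` regular at the closed points of
  `C = X ∩ V(t₀)`, `X ∩ V(t₀, t₁)` of dimension `≤ 0`, non-empty (projective dimension theorem),
  with `(t₀, t₁)_x = 𝔪_x` at its points (the tree's `LinSec` machinery of
  `Resolution/LinearSections*`, assembled);
* `LinSec.hypDivisor r ℓ hℓ` — the hyperplane-section Cartier divisor `H = X ∩ V(ℓ)` of a linear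
  form `ℓ ∉ I(X)` (charts `X_h = r⁻¹D₊(x_h)`, local equations `ℓ/x_h`), with its sections
  `1` (`hypDivisor_isSection_one`) and `ℓ'/ℓ` (`LinSec.ratioFn`, `hypDivisor_isSection_ratioFn`),
  whose coordinates on an analytification are the functions `(ℓ/x_h) ∘ φ`, `(ℓ'/x_h) ∘ φ`
  (`sectionCoord_hypDivisor_one`, `sectionCoord_hypDivisor_ratioFn`);
* `exists_transverse_pencil` — **the assembled analytic statement for surfaces**: for `X` a smooth
  projective surface and `φ : M → X(ℂ)` an analytification there are `H`, `s ∈ Γ(X, 𝒪_X(H))` as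
  above such that the holomorphic coordinates `t_a`, `t'_a` of the sections `1`, `s` of `𝒪_X(H)^an`
  satisfy `dt_a ≠ 0` on `{t_a = 0}`, `(dt_a, dt'_a)` onto `ℂ²` on `{t_a = t'_a = 0}`, and
  `{t = t' = 0} ≠ ∅`;
* `eq_zero_of_sum_smul_mem_ker_sq_of_isRegularLocalRing_quotient`,
  `surjective_pi_mfderiv_evalOrZero_comp_of_isRegularLocalRing_quotient`,
  `exists_linForms_regularFlag`, `exists_transverse_flag` — **the same in all dimensions `n`**:
  `n` general linear forms `t₀, …, t_{n-1}` (`𝒪_{X,x}/(t₀, …, t_{j-1})` regular of dimension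
  `n - j` at the closed points of `X ∩ V(t₀, …, t_{j-1})` for every `j ≤ n`, the last intersection
  finite, non-empty, of closed points; Matsumura 14.2 (3) ⇒ (1) for the independence modulo `𝔪²`),
  and on the analytification the sections `sⱼ = tⱼ/t₀` of `𝒪_X(H)`, `H = X ∩ V(t₀)`, whose
  coordinates have jointly surjective differentials along the flag, a finite non-empty common zero
  set, and dense non-vanishing loci (GAGA Prop. 5) — the flag of Serre's / Mumford's induction over
  hyperplane sections (FAC n° 81, *Abelian Varieties* §16).

Everything is proved; the only definitions are `LinSec.hypDivisor` and `LinSec.ratioFn`.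

## References

* J.-P. Serre, *Géométrie algébrique et géométrie analytique*, Ann. Inst. Fourier 6 (1956), §1
  n° 4, §2 n° 6 Prop. 3 Cor. 2, n° 16 Lemme 8. [SerreGAGA1956]
* H. Matsumura, *Commutative Ring Theory* (1987), Thm. 14.2. [Matsumura1987]
* R. Hartshorne, *Algebraic Geometry* (1977), I Thm. 7.2, II.7 (p. 157) and Prop. 7.7,
  II Thm. 8.18 and Rem. 8.18.1, II Ex. 3.20. [Hartshorne1977]
* U. Görtz, T. Wedhorn, *Algebraic Geometry I*, 2nd ed. (2020), Thm. 5.22, Lemma 6.26, (11.9).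
  [GortzWedhorn2020]
-/

noncomputable section

open scoped Manifold ContDiff Topology
open CategoryTheory AlgebraicGeometry Filter IsLocalRing
open Literature.AlgebraicGeometry.Motives
open Literature.AlgebraicGeometry.Motives.AlgPoints (evalOrZero evalOrZero_of_mem evalOrZero_of_not_mem)
open Literature.NumberTheory.Transcendental

universe u

namespace Literature.AlgebraicGeometry.HodgeTheory

namespace GAGADimension

/-! ### Algebra: `R/(x)` regular forces `x ∉ 𝔪²` -/

/-- **Matsumura Thm. 14.2, one element, converse direction**: in a regular local ring `R`, if
`x ∈ 𝔪` is non-zero and `R/(x)` is a regular local ring, then `x ∉ 𝔪²` (the quotient has dimension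
`dim R - 1`, `x` being a non-zero-divisor of the domain `R`, so `{x}` extends to a regular system of
parameters and its image in `𝔪/𝔪²` is non-zero). [cite: Matsumura1987, Thm. 14.2] -/
theorem notMem_sq_of_isRegularLocalRing_quotient {R : Type u} [CommRing R] [IsRegularLocalRing R]
    {x : R} (hx : x ∈ maximalIdeal R) (hx0 : x ≠ 0)
    (hreg : IsRegularLocalRing (R ⧸ Ideal.span {x})) : x ∉ maximalIdeal R ^ 2 := by
  classical
  haveI : IsDomain R := Literature.AlgebraicGeometry.Resolution.isDomain_of_isRegularLocalRing R
  have sub : ((({x} : Finset R) : Set R)) ⊆ maximalIdeal R := by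
    rw [Finset.coe_singleton, Set.singleton_subset_iff]
    exact hx
  have hdim : ringKrullDim (R ⧸ Ideal.span ((({x} : Finset R)) : Set R)) + ({x} : Finset R).card =
      ringKrullDim R := by
    rw [Finset.coe_singleton, Finset.card_singleton, Nat.cast_one]
    refine le_antisymm
      (ringKrullDim_quotient_succ_le_of_nonZeroDivisor (mem_nonZeroDivisors_of_ne_zero hx0)) ?_
    have h := ringKrullDim_le_ringKrullDim_quotient_add_card ({x} : Finset R)
      (by simpa [IsLocalRing.ringJacobson_eq_maximalIdeal] using sub)
    rwa [Finset.coe_singleton, Finset.card_singleton, Nat.cast_one] at h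
  have hreg' : IsRegularLocalRing (R ⧸ Ideal.span ((({x} : Finset R)) : Set R)) := by
    rwa [Finset.coe_singleton]
  have h3 : IsRegularLocalRing (R ⧸ Ideal.span ((({x} : Finset R)) : Set R)) ∧
      ringKrullDim (R ⧸ Ideal.span ((({x} : Finset R)) : Set R)) + ({x} : Finset R).card =
        ringKrullDim R := ⟨hreg', hdim⟩
  have hli := ((Literature.AlgebraicGeometry.Resolution.quotient_isRegularLocalRing_tfae R {x} sub).out
    2 1).mp h3
  intro hx2
  have hzero : ((⇑(maximalIdeal R).toCotangent).comp (Set.inclusion sub))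
      ⟨x, by rw [Finset.coe_singleton]; exact Set.mem_singleton x⟩ = 0 := by
    rw [Function.comp_apply, Ideal.toCotangent_eq_zero]
    exact hx2
  exact hli.ne_zero _ hzero

end GAGADimension

/-! ### Independence modulo `𝔪²` read in an affine chart -/

section Chart

variable {X : SchemeOver ℂ} {U : X.left.Opens} (Q : ComplexPoints X) (hQU : Q.pt ∈ U)

/-- Functions vanishing at `Q` have non-unit germs at `Q.pt`: the kernel of evaluation at `Q` maps
into the maximal ideal of `𝒪_{X,Q}`. [folklore] -/
theorem germ_mem_maximalIdeal_of_eval_eq_zero {f : Γ(X.left, U)} (hf : Q.eval U hQU f = 0) :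
    (X.left.presheaf.germ U Q.pt hQU) f ∈ maximalIdeal (X.left.presheaf.stalk Q.pt) := by
  rw [IsLocalRing.mem_maximalIdeal, mem_nonunits_iff]
  intro hunit
  have hmem : Q.pt ∈ X.left.basicOpen f := (X.left.mem_basicOpen f Q.pt hQU).2 hunit
  exact ((AlgPoints.pt_mem_basicOpen_iff Q hQU f).1 hmem) hf

/-- The square of the kernel of evaluation at `Q` maps into `𝔪_{Q}²`. [folklore] -/
theorem germ_mem_sq_of_mem_ker_sq {f : Γ(X.left, U)}
    (hf : f ∈ RingHom.ker (Q.evalRingHom U hQU) ^ 2) :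
    (X.left.presheaf.germ U Q.pt hQU) f ∈ maximalIdeal (X.left.presheaf.stalk Q.pt) ^ 2 := by
  have hle : (RingHom.ker (Q.evalRingHom U hQU)).map (X.left.presheaf.germ U Q.pt hQU).hom ≤
      maximalIdeal (X.left.presheaf.stalk Q.pt) := by
    refine Ideal.map_le_iff_le_comap.2 fun a ha ↦ ?_
    exact germ_mem_maximalIdeal_of_eval_eq_zero Q hQU (by simpa [RingHom.mem_ker] using ha)
  have h2 : (RingHom.ker (Q.evalRingHom U hQU) ^ 2).map (X.left.presheaf.germ U Q.pt hQU).hom ≤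
      maximalIdeal (X.left.presheaf.stalk Q.pt) ^ 2 := by
    rw [Ideal.map_pow]
    exact Ideal.pow_right_mono hle 2
  exact h2 (Ideal.mem_map_of_mem _ hf)

/-- **One function outside `𝔪²`**: if the germ of `g` at `Q` is not in `𝔪_Q²`, then no non-zero
scalar multiple of `g` lies in `(ker ev_Q)²` — the hypothesis `hindep` of
`GAGADimension.surjective_pi_fderiv_chart` for `c = 1`. [folklore] -/
theorem eq_zero_of_smul_mem_ker_sq_of_germ_notMem_sq (g : Γ(X.left, U))
    (hg : (X.left.presheaf.germ U Q.pt hQU) g ∉ maximalIdeal (X.left.presheaf.stalk Q.pt) ^ 2)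
    (coef : Fin 1 → ℂ)
    (hmem : ∑ j, SchemeOver.scalarRingHom X U (coef j) * (fun _ : Fin 1 ↦ g) j ∈
      RingHom.ker (Q.evalRingHom U hQU) ^ 2) :
    coef = 0 := by
  by_contra hne
  have h0 : coef 0 ≠ 0 := by
    intro h
    exact hne (funext fun j ↦ by rw [Subsingleton.elim j 0, h]; rfl)
  simp only [Fin.sum_univ_one] at hmem
  have hunit : IsUnit (SchemeOver.scalarRingHom X U (coef 0)) := (h0.isUnit).map _
  have hg2 : g ∈ RingHom.ker (Q.evalRingHom U hQU) ^ 2 := by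
    have := Ideal.mul_mem_left _ (↑hunit.unit⁻¹ : Γ(X.left, U)) hmem
    rwa [← mul_assoc, IsUnit.val_inv_mul, one_mul] at this
  exact hg (germ_mem_sq_of_mem_ker_sq Q hQU hg2)

/-- **Generators of the maximal ideal are independent modulo `𝔪²`**: if the germs of
`g₁, …, g_c ∈ ker ev_Q` generate `𝔪_Q ⊂ 𝒪_{X,Q}` and `dim 𝒪_{X,Q} = c`, then a relation
`∑ λⱼ gⱼ ∈ (ker ev_Q)²` forces `λ = 0` (otherwise one generator is redundant modulo `𝔪²` and, by
Nakayama, `dim 𝒪_{X,Q} ≤ μ(𝔪) ≤ c - 1`). [folklore] -/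
theorem eq_zero_of_sum_smul_mem_ker_sq_of_span_germ_eq
    [IsNoetherianRing (X.left.presheaf.stalk Q.pt)] {c : ℕ} (g : Fin c → Γ(X.left, U))
    (hspan : Ideal.span (Set.range fun j ↦ (X.left.presheaf.germ U Q.pt hQU) (g j)) =
      maximalIdeal (X.left.presheaf.stalk Q.pt))
    (hdim : ringKrullDim (X.left.presheaf.stalk Q.pt) = c) (coef : Fin c → ℂ)
    (hmem : ∑ j, SchemeOver.scalarRingHom X U (coef j) * g j ∈ RingHom.ker (Q.evalRingHom U hQU) ^ 2) :
    coef = 0 := by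
  classical
  by_contra hne
  obtain ⟨j₀, hj₀⟩ : ∃ j₀, coef j₀ ≠ 0 := by
    by_contra h
    push Not at h
    exact hne (funext h)
  set R := X.left.presheaf.stalk Q.pt
  set γ : Γ(X.left, U) →+* R := (X.left.presheaf.germ U Q.pt hQU).hom with hγ
  set w : Fin c → R := fun j ↦ γ (g j) with hw
  have hwm : ∀ j, w j ∈ maximalIdeal R := fun j ↦
    hspan ▸ Ideal.subset_span ⟨j, rfl⟩
  have hwspan : maximalIdeal R ≤ Ideal.span (Set.range w) := hspan.symm.le
  -- the relation read in `R`
  have hrel : ∑ j, γ (SchemeOver.scalarRingHom X U (coef j)) * w j ∈ maximalIdeal R * maximalIdeal R := by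
    have h := germ_mem_sq_of_mem_ker_sq Q hQU hmem
    rw [pow_two] at h
    simpa only [hγ, map_sum, map_mul] using h
  have hunit : IsUnit (γ (SchemeOver.scalarRingHom X U (coef j₀))) := ((hj₀.isUnit).map _).map γ
  have hi₀ : w j₀ ∈ Ideal.span (w '' (Set.univ \ {j₀})) ⊔ maximalIdeal R * maximalIdeal R := by
    have hsplit : γ (SchemeOver.scalarRingHom X U (coef j₀)) * w j₀ =
        (∑ j, γ (SchemeOver.scalarRingHom X U (coef j)) * w j) -
          ∑ j ∈ Finset.univ.erase j₀, γ (SchemeOver.scalarRingHom X U (coef j)) * w j := by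
      rw [← Finset.add_sum_erase Finset.univ _ (Finset.mem_univ j₀), add_sub_cancel_right]
    have hmem' : γ (SchemeOver.scalarRingHom X U (coef j₀)) * w j₀ ∈
        Ideal.span (w '' (Set.univ \ {j₀})) ⊔ maximalIdeal R * maximalIdeal R := by
      rw [hsplit]
      refine Ideal.sub_mem _ (Ideal.mem_sup_right hrel) (Ideal.mem_sup_left ?_)
      refine Ideal.sum_mem _ fun j hj ↦ Ideal.mul_mem_left _ _ (Ideal.subset_span ?_)
      exact ⟨j, ⟨Set.mem_univ _, (Finset.mem_erase.1 hj).1⟩, rfl⟩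
    have := Ideal.mul_mem_left _ (↑hunit.unit⁻¹ : R) hmem'
    rwa [← mul_assoc, IsUnit.val_inv_mul, one_mul] at this
  have hle := GAGADimension.ringKrullDim_le_of_mem_span_erase w hwm hwspan j₀ hi₀
  rw [hdim, Fintype.card_fin] at hle
  have h1 : (c : ℕ) ≤ c - 1 := by exact_mod_cast hle
  have h2 := j₀.isLt
  omega


/-- **Part of a regular system of parameters is independent modulo `𝔪²`** (Matsumura Thm. 14.2,
(3) ⇒ (1), read through an affine chart): if `g₁, …, g_c ∈ ker ev_Q` have germs `w₁, …, w_c`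
such that `𝒪_{X,Q}/(w)` is a regular local ring and `dim 𝒪_{X,Q}/(w) + c ≤ dim 𝒪_{X,Q}`
(`𝒪_{X,Q}` regular), then a relation `∑ λⱼ gⱼ ∈ (ker ev_Q)²` forces `λ = 0`: the `wⱼ` are then
`c` distinct members of a regular system of parameters `T` (`#T = dim 𝒪_{X,Q}`), and a relation
with `λ_{j₀} ≠ 0` would make `w_{j₀}` redundant modulo `𝔪²`, whence `dim ≤ #T - 1` by Nakayama.
[cite: Matsumura1987, Thm. 14.2] -/
theorem eq_zero_of_sum_smul_mem_ker_sq_of_isRegularLocalRing_quotient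
    [IsRegularLocalRing (X.left.presheaf.stalk Q.pt)] {c : ℕ} (g : Fin c → Γ(X.left, U))
    (hg : ∀ j, Q.eval U hQU (g j) = 0)
    (hreg : IsRegularLocalRing (X.left.presheaf.stalk Q.pt ⧸
      Ideal.span (Set.range fun j ↦ (X.left.presheaf.germ U Q.pt hQU) (g j))))
    (hdim : ringKrullDim (X.left.presheaf.stalk Q.pt ⧸
        Ideal.span (Set.range fun j ↦ (X.left.presheaf.germ U Q.pt hQU) (g j))) + c ≤
      ringKrullDim (X.left.presheaf.stalk Q.pt))
    (coef : Fin c → ℂ)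
    (hmem : ∑ j, SchemeOver.scalarRingHom X U (coef j) * g j ∈ RingHom.ker (Q.evalRingHom U hQU) ^ 2) :
    coef = 0 := by
  classical
  by_contra hne
  obtain ⟨j₀, hj₀⟩ : ∃ j₀, coef j₀ ≠ 0 := by
    by_contra h
    push Not at h
    exact hne (funext h)
  set R := X.left.presheaf.stalk Q.pt
  set γ : Γ(X.left, U) →+* R := (X.left.presheaf.germ U Q.pt hQU).hom with hγ
  set w : Fin c → R := fun j ↦ γ (g j) with hw
  have hwm : ∀ j, w j ∈ maximalIdeal R := fun j ↦ germ_mem_maximalIdeal_of_eval_eq_zero Q hQU (hg j)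
  -- the finite set `S` of the germs; `dim R ≤ dim R/(S) + #S` forces `#S = c`, `w` injective
  set S : Finset R := Finset.univ.image w with hS
  have hSrange : (S : Set R) = Set.range w := by
    rw [hS, Finset.coe_image, Finset.coe_univ, Set.image_univ]
  have sub : (S : Set R) ⊆ maximalIdeal R := by
    rw [hSrange]
    rintro _ ⟨j, rfl⟩
    exact hwm j
  obtain ⟨d, hd⟩ := Literature.AlgebraicGeometry.Resolution.ringKrullDim_eq_nat R
  have hcard_le : S.card ≤ c := (Finset.card_image_le).trans (by simp)
  have hKrull : ringKrullDim R ≤ ringKrullDim (R ⧸ Ideal.span (S : Set R)) + S.card :=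
    ringKrullDim_le_ringKrullDim_quotient_add_card S (by simpa [IsLocalRing.ringJacobson_eq_maximalIdeal] using sub)
  rw [hSrange] at hKrull
  obtain ⟨d', hd'⟩ : ∃ d' : ℕ, ringKrullDim (R ⧸ Ideal.span (Set.range w)) = d' := by
    haveI : Nontrivial (R ⧸ Ideal.span (Set.range w)) :=
      Ideal.Quotient.nontrivial_iff.mpr (ne_top_of_le_ne_top (Ideal.IsPrime.ne_top inferInstance)
        (Ideal.span_le.2 (hSrange ▸ sub)))
    haveI : IsLocalRing (R ⧸ Ideal.span (Set.range w)) :=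
      IsLocalRing.of_surjective' _ Ideal.Quotient.mk_surjective
    haveI : IsNoetherianRing (R ⧸ Ideal.span (Set.range w)) := inferInstance
    exact Literature.AlgebraicGeometry.Resolution.ringKrullDim_eq_nat _
  rw [hd, hd'] at hKrull hdim
  have h1 : d ≤ d' + S.card := by exact_mod_cast hKrull
  have h2 : d' + c ≤ d := by exact_mod_cast hdim
  have hcard : S.card = c := le_antisymm hcard_le (by omega)
  have hwinj : Function.Injective w := by
    have := Finset.card_image_iff.1 (by rw [← hS, hcard, Finset.card_univ, Fintype.card_fin])
    exact fun a b h ↦ this (Finset.mem_univ a) (Finset.mem_univ b) h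
  -- the `wⱼ` extend to a regular system of parameters `T`
  have h3 : IsRegularLocalRing (R ⧸ Ideal.span (S : Set R)) ∧
      ringKrullDim (R ⧸ Ideal.span (S : Set R)) + S.card = ringKrullDim R := by
    rw [hSrange, hd, hd', hcard]
    have h7 : d' + c = d := by omega
    exact ⟨hreg, by exact_mod_cast h7⟩
  obtain ⟨T, hST, hTcard, hTspan⟩ :=
    ((Literature.AlgebraicGeometry.Resolution.quotient_isRegularLocalRing_tfae R S sub).out 2 0).mp h3
  -- the relation read in `R`: `w j₀` is redundant in `T` modulo `𝔪²`
  have hrel : ∑ j, γ (SchemeOver.scalarRingHom X U (coef j)) * w j ∈ maximalIdeal R * maximalIdeal R := by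
    have h := germ_mem_sq_of_mem_ker_sq Q hQU hmem
    rw [pow_two] at h
    simpa only [hγ, map_sum, map_mul] using h
  have hunit : IsUnit (γ (SchemeOver.scalarRingHom X U (coef j₀))) := ((hj₀.isUnit).map _).map γ
  have hTm : ∀ i : ↥T, (i : R) ∈ maximalIdeal R := fun i ↦ by
    rw [← hTspan]; exact Ideal.subset_span i.2
  have hTw : maximalIdeal R ≤ Ideal.span (Set.range (Subtype.val : ↥T → R)) := by
    rw [Subtype.range_coe_subtype, Finset.setOf_mem, hTspan]
  have hj₀T : w j₀ ∈ T := hST (by rw [hS]; exact Finset.mem_image_of_mem w (Finset.mem_univ j₀))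
  have hi₀ : (⟨w j₀, hj₀T⟩ : ↥T).1 ∈
      Ideal.span (Subtype.val '' (Set.univ \ {(⟨w j₀, hj₀T⟩ : ↥T)})) ⊔ maximalIdeal R * maximalIdeal R := by
    have hsplit : γ (SchemeOver.scalarRingHom X U (coef j₀)) * w j₀ =
        (∑ j, γ (SchemeOver.scalarRingHom X U (coef j)) * w j) -
          ∑ j ∈ Finset.univ.erase j₀, γ (SchemeOver.scalarRingHom X U (coef j)) * w j := by
      rw [← Finset.add_sum_erase Finset.univ _ (Finset.mem_univ j₀), add_sub_cancel_right]
    have hmem' : γ (SchemeOver.scalarRingHom X U (coef j₀)) * w j₀ ∈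
        Ideal.span (Subtype.val '' (Set.univ \ {(⟨w j₀, hj₀T⟩ : ↥T)})) ⊔ maximalIdeal R * maximalIdeal R := by
      rw [hsplit]
      refine Ideal.sub_mem _ (Ideal.mem_sup_right hrel) (Ideal.mem_sup_left ?_)
      refine Ideal.sum_mem _ fun j hj ↦ Ideal.mul_mem_left _ _ (Ideal.subset_span ?_)
      have hjT : w j ∈ T := hST (by rw [hS]; exact Finset.mem_image_of_mem w (Finset.mem_univ j))
      refine ⟨⟨w j, hjT⟩, ⟨Set.mem_univ _, ?_⟩, rfl⟩
      intro h
      have : w j = w j₀ := congrArg Subtype.val (Set.mem_singleton_iff.1 h)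
      exact (Finset.mem_erase.1 hj).1 (hwinj this)
    have := Ideal.mul_mem_left _ (↑hunit.unit⁻¹ : R) hmem'
    rwa [← mul_assoc, IsUnit.val_inv_mul, one_mul] at this
  have hle := GAGADimension.ringKrullDim_le_of_mem_span_erase (Subtype.val : ↥T → R) hTm hTw ⟨w j₀, hj₀T⟩ hi₀
  rw [Fintype.card_coe, hd] at hle
  have hTcard' : (T.card : WithBot ℕ∞) = d := by rw [hTcard, hd]
  have hTc : T.card = d := by exact_mod_cast hTcard'
  rw [hTc] at hle
  have h4 : d ≤ d - 1 := by exact_mod_cast hle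
  have h5 : c ≤ d := by omega
  have h6 := j₀.isLt
  omega

end Chart

/-! ### Independent algebraic differentials are independent analytic differentials -/

section Transport

variable {n : ℕ} {X : SchemeOver ℂ}

/-- **The local ring at a complex point of a smooth projective `n`-fold has dimension `n`**: a
complex point is closed (`dim closure {x} = 0`) and `dim 𝒪_{X,x} + dim closure {x} = dim X = n`.
[cite: GortzWedhorn2020, Thm. 5.22 and Lemma 6.26] -/
theorem ringKrullDim_stalk_pt_eq (hX : IsSmoothProjective n X) (Q : ComplexPoints X) :
    ringKrullDim (X.left.presheaf.stalk Q.pt) = n := by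
  haveI := hX.smoothOfRelativeDimension
  haveI : LocallyOfFiniteType X.hom := by
    haveI : Smooth X.hom := SmoothOfRelativeDimension.smooth n _
    infer_instance
  haveI : IsIntegral X.left := IsSmoothProjective.isIntegral_holds hX
  have hclosed : IsClosed ({Q.pt} : Set X.left) := ComplexPoints.isClosed_pt Q
  have hheight : Order.height Q.pt = 0 := by
    rw [Order.height_eq_zero]
    intro y hy
    have hy' : y ∈ closure ({Q.pt} : Set X.left) := specializes_iff_mem_closure.1 hy
    rw [hclosed.closure_eq, Set.mem_singleton_iff] at hy'
    exact hy'.symm.le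
  have hcoh : Order.coheight Q.pt = (n : ℕ∞) := by
    haveI : Nonempty X.left := ⟨Q.pt⟩
    have h1 := Literature.AlgebraicGeometry.Dimension.coheight_add_height_eq_topologicalKrullDim X.hom Q.pt
    rw [hheight, add_zero, topologicalKrullDim_eq_of_smoothOfRelativeDimension X.hom n] at h1
    exact_mod_cast h1
  rw [ringKrullDim_stalk_eq_coheight Q.pt, hcoh]
  rfl

set_option backward.isDefEq.respectTransparency false in
open GAGADimension in
/-- **Independent algebraic differentials are independent analytic differentials on any
analytification.** Let `X` be smooth projective of dimension `n` over `ℂ`, `φ : M → X(ℂ)` an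
analytification with a holomorphic atlas on `M`, `U ⊆ X` an affine open and `m ∈ M` with
`φ m ∈ U(ℂ)`. If `g₁, …, g_c ∈ Γ(X, U)` vanish at `φ m` and are linearly independent modulo
`(ker ev_{φ m})²` over `ℂ`, then `v ↦ (d(g₁ ∘ φ)(m) v, …, d(g_c ∘ φ)(m) v)` is onto `ℂᶜ`. The local
ring `𝒪_{X, φ m}` is regular of dimension `n` (`X` smooth, `φ m` closed), so local coordinates modulo
`𝔪²` exist (`exists_sub_sum_smul_mem_sq`); the differentials are onto in the algebraic-chart model of
`X^h` (`surjective_pi_fderiv_chart`) and this is moved to `M` along the biholomorphism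
`X(ℂ) ≃ M` over `X(ℂ)` (`IsAnalytification.unique_holds`). Serre, GAGA §2 n° 6 Cor. 2 with §1 n° 4:
simple points of a subvariety are points where the analytic space is a submanifold cut out by the
algebraic equations. [cite: SerreGAGA1956, §2 n°6 Cor. 2 with §1 n°4] -/
theorem surjective_pi_mfderiv_evalOrZero_comp (hX : IsSmoothProjective n X)
    {E : Type} [NormedAddCommGroup E] [NormedSpace ℂ E] [FiniteDimensional ℂ E]
    {M : Type} [TopologicalSpace M] [ChartedSpace E M] [IsManifold 𝓘(ℂ, E) ω M]
    {φ : M → ComplexPoints X} (hφ : IsAnalytification E X n φ)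
    {U : X.left.Opens} (hU : IsAffineOpen U) {m : M} {Q : ComplexPoints X} (hQ : φ m = Q)
    (hQU : Q.pt ∈ U) {c : ℕ} (g : Fin c → Γ(X.left, U)) (hg : ∀ j, Q.eval U hQU (g j) = 0)
    (hindep : ∀ coef : Fin c → ℂ,
      ∑ j, SchemeOver.scalarRingHom X U (coef j) * g j ∈ RingHom.ker (Q.evalRingHom U hQU) ^ 2 →
        coef = 0) :
    Function.Surjective (ContinuousLinearMap.pi fun j ↦
      mfderiv 𝓘(ℂ, E) 𝓘(ℂ, ℂ) (fun m' ↦ evalOrZero U (g j) (φ m')) m) := by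
  classical
  haveI := hX.smoothOfRelativeDimension
  haveI : LocallyOfFiniteType X.hom := by
    haveI : Smooth X.hom := SmoothOfRelativeDimension.smooth n _
    infer_instance
  haveI : IsLocallyNoetherian X.left := LocallyOfFiniteType.isLocallyNoetherian X.hom
  -- Step 1: the model `X(ℂ)` of `X^h` with algebraic charts, an analytification via `id`
  choose chart mem alg hol using fun P : ComplexPoints X ↦ exists_algebraicChart_holds X n P
  letI cs : ChartedSpace (Fin n → ℂ) (ComplexPoints X) := chartedSpaceOfCharts chart mem
  haveI hM₀ : IsManifold 𝓘(ℂ, Fin n → ℂ) ω (ComplexPoints X) :=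
    isManifold_chartedSpaceOfCharts chart mem alg hol
  have hid : IsAnalytification (Fin n → ℂ) X n (id : ComplexPoints X → ComplexPoints X) := by
    refine ⟨IsHomeomorph.id, by simp, ?_⟩
    intro V s P hP
    simp only [Set.preimage_id_eq, id_eq, Set.mem_setOf_eq] at hP
    refine MDifferentiableAt.mdifferentiableWithinAt ?_
    rw [mdifferentiableAt_iff]
    refine ⟨(AlgPoints.continuousOn_evalOrZero _ s).continuousAt
      ((AlgPoints.isOpen_setOf_pt_mem _).mem_nhds hP), ?_⟩
    simp only [writtenInExtChartAt, extChartAt, OpenPartialHomeomorph.extend,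
      modelWithCornersSelf_partialEquiv, PartialEquiv.trans_refl, modelWithCornersSelf_coe,
      Set.range_id, OpenPartialHomeomorph.toFun_eq_coe,
      OpenPartialHomeomorph.coe_toPartialEquiv_symm]
    refine DifferentiableAt.differentiableWithinAt ?_
    have hopen : IsOpen ((chart P).target ∩ (chart P).symm ⁻¹' {Q | Q.pt ∈ (↑V : X.left.Opens)}) :=
      (chart P).isOpen_inter_preimage_symm (AlgPoints.isOpen_setOf_pt_mem _)
    have hmem : chart P P ∈ (chart P).target ∩ (chart P).symm ⁻¹' {Q | Q.pt ∈ (↑V : X.left.Opens)} :=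
      ⟨(chart P).map_source (mem P), by
        simp only [Set.mem_preimage, Set.mem_setOf_eq, (chart P).left_inv (mem P)]; exact hP⟩
    exact ((hol P V s).differentiableOn (by simp)).differentiableAt (hopen.mem_nhds hmem)
  -- Step 2: the prime `𝔭` of `Q` in `A = Γ(X, U)`: it is `ker ev_Q`, maximal and `ℂ`-rational;
  -- `𝒪_{X,Q} = A_𝔭` is regular of dimension `n`, so local coordinates modulo `𝔭²` exist
  letI : Algebra ℂ Γ(X.left, U) := (SchemeOver.scalarRingHom X U).toAlgebra
  haveI : IsNoetherianRing Γ(X.left, U) := IsLocallyNoetherian.component_noetherian ⟨U, hU⟩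
  letI : Algebra Γ(X.left, U) (X.left.presheaf.stalk Q.pt) :=
    TopCat.Presheaf.algebra_section_stalk X.left.presheaf (⟨Q.pt, hQU⟩ : U)
  have hbasic : ∀ (y : U) (f : Γ(X.left, U)), (y : X.left) ∈ X.left.basicOpen f ↔
      f ∉ (hU.primeIdealOf y).asIdeal := fun y f ↦ mem_basicOpen_iff_notMem_primeIdealOf hU y f
  have hevalmem : ∀ f : Γ(X.left, U), Q.eval U hQU f = 0 ↔ f ∈ (hU.primeIdealOf ⟨Q.pt, hQU⟩).asIdeal :=
    fun f ↦ not_iff_not.1 ((AlgPoints.pt_mem_basicOpen_iff Q hQU f).symm.trans (hbasic ⟨Q.pt, hQU⟩ f))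
  have hker : RingHom.ker (Q.evalRingHom U hQU) = (hU.primeIdealOf ⟨Q.pt, hQU⟩).asIdeal :=
    Ideal.ext fun f ↦ by rw [RingHom.mem_ker, AlgPoints.evalRingHom_apply, hevalmem]
  have hkermax : (hU.primeIdealOf ⟨Q.pt, hQU⟩).asIdeal.IsMaximal := by
    rw [← hker]
    exact RingHom.ker_isMaximal_of_surjective _ fun r ↦ ⟨SchemeOver.scalarRingHom X U r, by
      rw [AlgPoints.evalRingHom_apply, AlgPoints.eval_scalarRingHom]; rfl⟩
  haveI hloc : IsLocalization.AtPrime (X.left.presheaf.stalk Q.pt) (hU.primeIdealOf ⟨Q.pt, hQU⟩).asIdeal :=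
    hU.isLocalization_stalk ⟨Q.pt, hQU⟩
  haveI hregQ : IsRegularLocalRing (X.left.presheaf.stalk Q.pt) :=
    isRegularLocalRing_stalk_of_smoothOfRelativeDimension X.hom n Q.pt
  let e : Localization.AtPrime (hU.primeIdealOf ⟨Q.pt, hQU⟩).asIdeal ≃ₐ[Γ(X.left, U)]
      X.left.presheaf.stalk Q.pt :=
    IsLocalization.algEquiv (hU.primeIdealOf ⟨Q.pt, hQU⟩).asIdeal.primeCompl _ _
  haveI hreg𝔭 : IsRegularLocalRing (Localization.AtPrime (hU.primeIdealOf ⟨Q.pt, hQU⟩).asIdeal) :=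
    IsRegularLocalRing.of_ringEquiv e.symm.toRingEquiv
  have hdim𝔭 : ringKrullDim (Localization.AtPrime (hU.primeIdealOf ⟨Q.pt, hQU⟩).asIdeal) = n := by
    rw [ringKrullDim_eq_of_ringEquiv e.toRingEquiv, ringKrullDim_stalk_pt_eq hX Q]
  let ψ : Γ(X.left, U) →ₐ[ℂ] ℂ :=
    { Q.evalRingHom U hQU with
      commutes' := fun r ↦
        show Q.eval U hQU (SchemeOver.scalarRingHom X U r) = algebraMap ℂ ℂ r from
          AlgPoints.eval_scalarRingHom Q hQU r }
  have hψ : ∀ a, ψ a = 0 ↔ a ∈ (hU.primeIdealOf ⟨Q.pt, hQU⟩).asIdeal := fun a ↦ by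
    rw [← hker, RingHom.mem_ker]; rfl
  haveI := hkermax
  obtain ⟨t, -, htspan⟩ := exists_sub_sum_smul_mem_sq ℂ (hU.primeIdealOf ⟨Q.pt, hQU⟩).asIdeal hdim𝔭 ψ hψ
  have htspan' : ∀ a ∈ RingHom.ker (Q.evalRingHom U hQU), ∃ coef : Fin n → ℂ,
      a - ∑ i, SchemeOver.scalarRingHom X U (coef i) * t i ∈ RingHom.ker (Q.evalRingHom U hQU) ^ 2 := by
    intro a ha
    rw [hker] at ha ⊢
    obtain ⟨coef, hcoef⟩ := htspan a ha
    refine ⟨coef, ?_⟩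
    simp only [Algebra.smul_def] at hcoef
    exact hcoef
  have hg' : ∀ j, g j ∈ RingHom.ker (Q.evalRingHom U hQU) := fun j ↦ by
    rw [RingHom.mem_ker, AlgPoints.evalRingHom_apply]; exact hg j
  -- Step 3: the differentials are onto in the model
  have hsurj := surjective_pi_fderiv_chart (chart Q) (mem Q) (hol Q) ⟨U, hU⟩ hQU t htspan' (alg Q) g hg'
    hindep
  have hmd : ∀ j, MDifferentiableAt 𝓘(ℂ, Fin n → ℂ) 𝓘(ℂ, ℂ) (evalOrZero U (g j)) Q := fun j ↦
    ((hid.mdifferentiableOn_evalOrZero ⟨U, hU⟩ (g j)).mdifferentiableAt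
      ((AlgPoints.isOpen_setOf_pt_mem U).mem_nhds hQU))
  have heq : ∀ j, mfderiv 𝓘(ℂ, Fin n → ℂ) 𝓘(ℂ, ℂ) (evalOrZero U (g j)) Q =
      fderiv ℂ (evalOrZero U (g j) ∘ (chart Q).symm) (chart Q Q) := fun j ↦ by
    rw [(hmd j).mfderiv, ModelWithCorners.range_eq_univ, fderivWithin_univ]
    rfl
  have hsurj₀ : Function.Surjective (ContinuousLinearMap.pi fun j ↦
      mfderiv 𝓘(ℂ, Fin n → ℂ) 𝓘(ℂ, ℂ) (evalOrZero U (g j)) Q) := by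
    have hpi : (ContinuousLinearMap.pi fun j ↦ mfderiv 𝓘(ℂ, Fin n → ℂ) 𝓘(ℂ, ℂ) (evalOrZero U (g j)) Q) =
        ContinuousLinearMap.pi fun j ↦ fderiv ℂ (evalOrZero U (g j) ∘ (chart Q).symm) (chart Q Q) := by
      ext v j
      simp only [ContinuousLinearMap.pi_apply, heq]
      rfl
    rw [hpi]
    exact hsurj
  -- Step 4: transport to `M` along the biholomorphism `χ : X(ℂ) ≃ M` over `X(ℂ)`
  obtain ⟨χ, hχ, -, hcomp⟩ :=
    IsAnalytification.unique_holds (E := Fin n → ℂ) (E' := E) (M := ComplexPoints X) (M' := M) hid hφ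
  have hχQ : χ Q = m :=
    hφ.isHomeomorph.injective ((show φ (χ Q) = Q from congrFun hcomp Q).trans hQ.symm)
  have hFχ : ∀ j, (fun m' ↦ evalOrZero U (g j) (φ m')) ∘ χ = evalOrZero U (g j) := fun j ↦ by
    funext P
    simp only [Function.comp_apply, show φ (χ P) = P from congrFun hcomp P]
  have hFd : ∀ j, MDifferentiableOn 𝓘(ℂ, E) 𝓘(ℂ, ℂ) (fun m' ↦ evalOrZero U (g j) (φ m'))
      (φ ⁻¹' {P | P.pt ∈ U}) := fun j ↦
    IsAnalytification.mdifferentiableOn_evalOrZero_opens_holds hφ U (g j)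
  have hmU' : m ∈ φ ⁻¹' {P : ComplexPoints X | P.pt ∈ U} := by
    show (φ m).pt ∈ U
    rw [hQ]; exact hQU
  have hFat : ∀ j, MDifferentiableAt 𝓘(ℂ, E) 𝓘(ℂ, ℂ) (fun m' ↦ evalOrZero U (g j) (φ m')) (χ Q) :=
    fun j ↦ by
    rw [hχQ]
    exact (hFd j).mdifferentiableAt ((hφ.isOpen_preimage U).mem_nhds hmU')
  suffices h : Function.Surjective (ContinuousLinearMap.pi fun j ↦
      mfderiv 𝓘(ℂ, E) 𝓘(ℂ, ℂ) (fun m' ↦ evalOrZero U (g j) (φ m')) (χ Q)) by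
    rw [hχQ] at h
    exact h
  have hcompχ : (ContinuousLinearMap.pi fun j ↦
      mfderiv 𝓘(ℂ, E) 𝓘(ℂ, ℂ) (fun m' ↦ evalOrZero U (g j) (φ m')) (χ Q)).comp
      (mfderiv 𝓘(ℂ, Fin n → ℂ) 𝓘(ℂ, E) χ Q) =
      ContinuousLinearMap.pi fun j ↦ mfderiv 𝓘(ℂ, Fin n → ℂ) 𝓘(ℂ, ℂ) (evalOrZero U (g j)) Q := by
    rw [ContinuousLinearMap.pi_comp]
    congr 1
    funext j
    have h := mfderiv_comp Q (hFat j) (hχ Q)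
    rw [hFχ j] at h
    exact h.symm
  have h2 : Function.Surjective ((ContinuousLinearMap.pi fun j ↦
      mfderiv 𝓘(ℂ, E) 𝓘(ℂ, ℂ) (fun m' ↦ evalOrZero U (g j) (φ m')) (χ Q)).comp
      (mfderiv 𝓘(ℂ, Fin n → ℂ) 𝓘(ℂ, E) χ Q)) := by
    rw [hcompχ]
    exact hsurj₀
  exact Function.Surjective.of_comp h2

/-- **Corollary (`c = 1`): the analytic differential of a regular function with regular
quotient is non-zero.** If `g ∈ Γ(X, U)` vanishes at `Q = φ m`, is non-zero in `𝒪_{X, Q}` and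
`𝒪_{X, Q}/(g)` is a regular local ring (e.g. `g` a local equation of a hyperplane section through a
point at which the section is regular, Bertini), then `d(g ∘ φ)(m) ≠ 0`.
[cite: SerreGAGA1956, §2 n°6 Cor. 2 with §1 n°4] [cite: Matsumura1987, Thm. 14.2] -/
theorem mfderiv_evalOrZero_comp_ne_zero_of_isRegularLocalRing_quotient (hX : IsSmoothProjective n X)
    {E : Type} [NormedAddCommGroup E] [NormedSpace ℂ E] [FiniteDimensional ℂ E]
    {M : Type} [TopologicalSpace M] [ChartedSpace E M] [IsManifold 𝓘(ℂ, E) ω M]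
    {φ : M → ComplexPoints X} (hφ : IsAnalytification E X n φ)
    {U : X.left.Opens} (hU : IsAffineOpen U) {m : M} {Q : ComplexPoints X} (hQ : φ m = Q)
    (hQU : Q.pt ∈ U) (g : Γ(X.left, U)) (hg : Q.eval U hQU g = 0)
    (hg0 : (X.left.presheaf.germ U Q.pt hQU) g ≠ 0)
    (hreg : IsRegularLocalRing (X.left.presheaf.stalk Q.pt ⧸
      Ideal.span {(X.left.presheaf.germ U Q.pt hQU) g})) :
    mfderiv 𝓘(ℂ, E) 𝓘(ℂ, ℂ) (fun m' ↦ evalOrZero U g (φ m')) m ≠ 0 := by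
  haveI := hX.smoothOfRelativeDimension
  haveI hregQ : IsRegularLocalRing (X.left.presheaf.stalk Q.pt) :=
    isRegularLocalRing_stalk_of_smoothOfRelativeDimension X.hom n Q.pt
  have hnot : (X.left.presheaf.germ U Q.pt hQU) g ∉ maximalIdeal (X.left.presheaf.stalk Q.pt) ^ 2 :=
    GAGADimension.notMem_sq_of_isRegularLocalRing_quotient
      (germ_mem_maximalIdeal_of_eval_eq_zero Q hQU hg) hg0 hreg
  have hsurj := surjective_pi_mfderiv_evalOrZero_comp hX hφ hU hQ hQU (fun _ : Fin 1 ↦ g) (fun _ ↦ hg)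
    (eq_zero_of_smul_mem_ker_sq_of_germ_notMem_sq Q hQU g hnot)
  intro h0
  obtain ⟨v, hv⟩ := hsurj (show Fin 1 → ℂ from fun _ ↦ 1)
  have h1 : (show E →L[ℂ] ℂ from mfderiv 𝓘(ℂ, E) 𝓘(ℂ, ℂ) (fun m' ↦ evalOrZero U g (φ m')) m) v =
      (1 : ℂ) := congrFun hv ⟨0, Nat.one_pos⟩
  have h2 : (0 : ℂ) = 1 := by
    rw [← h1, h0]
    rfl
  exact zero_ne_one h2

/-- **Corollary (`c = n`): generators of the maximal ideal are holomorphic local coordinates.**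
If `g₁, …, gₙ ∈ Γ(X, U)` vanish at `Q = φ m` and their germs generate the maximal ideal of
`𝒪_{X, Q}` (`n = dim X`), then `(d(g₁ ∘ φ), …, d(gₙ ∘ φ))(m) : T_m M → ℂⁿ` is onto (hence
bijective, `dim M = n`). [cite: SerreGAGA1956, §2 n°6 Cor. 2 with §1 n°4] -/
theorem surjective_pi_mfderiv_evalOrZero_comp_of_span_eq_maximalIdeal (hX : IsSmoothProjective n X)
    {E : Type} [NormedAddCommGroup E] [NormedSpace ℂ E] [FiniteDimensional ℂ E]
    {M : Type} [TopologicalSpace M] [ChartedSpace E M] [IsManifold 𝓘(ℂ, E) ω M]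
    {φ : M → ComplexPoints X} (hφ : IsAnalytification E X n φ)
    {U : X.left.Opens} (hU : IsAffineOpen U) {m : M} {Q : ComplexPoints X} (hQ : φ m = Q)
    (hQU : Q.pt ∈ U) (g : Fin n → Γ(X.left, U)) (hg : ∀ j, Q.eval U hQU (g j) = 0)
    (hspan : Ideal.span (Set.range fun j ↦ (X.left.presheaf.germ U Q.pt hQU) (g j)) =
      maximalIdeal (X.left.presheaf.stalk Q.pt)) :
    Function.Surjective (ContinuousLinearMap.pi fun j ↦
      mfderiv 𝓘(ℂ, E) 𝓘(ℂ, ℂ) (fun m' ↦ evalOrZero U (g j) (φ m')) m) := by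
  haveI := hX.smoothOfRelativeDimension
  haveI hregQ : IsRegularLocalRing (X.left.presheaf.stalk Q.pt) :=
    isRegularLocalRing_stalk_of_smoothOfRelativeDimension X.hom n Q.pt
  exact surjective_pi_mfderiv_evalOrZero_comp hX hφ hU hQ hQU g hg
    (eq_zero_of_sum_smul_mem_ker_sq_of_span_germ_eq Q hQU g hspan (ringKrullDim_stalk_pt_eq hX Q))

/-- **Corollary (regular quotient of the expected dimension): part of a regular system of
parameters gives independent analytic differentials.** If `g₁, …, g_c ∈ Γ(X, U)` vanish at
`Q = φ m`, `𝒪_{X,Q}/(g)` is a regular local ring and `dim 𝒪_{X,Q}/(g) + c ≤ n` (e.g. `(g)` the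
local equations of `c` general hyperplane sections through `Q`, Bertini), then
`(d(g₁ ∘ φ), …, d(g_c ∘ φ))(m) : T_m M → ℂᶜ` is onto.
[cite: SerreGAGA1956, §2 n°6 Cor. 2 with §1 n°4] [cite: Matsumura1987, Thm. 14.2] -/
theorem surjective_pi_mfderiv_evalOrZero_comp_of_isRegularLocalRing_quotient
    (hX : IsSmoothProjective n X)
    {E : Type} [NormedAddCommGroup E] [NormedSpace ℂ E] [FiniteDimensional ℂ E]
    {M : Type} [TopologicalSpace M] [ChartedSpace E M] [IsManifold 𝓘(ℂ, E) ω M]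
    {φ : M → ComplexPoints X} (hφ : IsAnalytification E X n φ)
    {U : X.left.Opens} (hU : IsAffineOpen U) {m : M} {Q : ComplexPoints X} (hQ : φ m = Q)
    (hQU : Q.pt ∈ U) {c : ℕ} (g : Fin c → Γ(X.left, U)) (hg : ∀ j, Q.eval U hQU (g j) = 0)
    (hreg : IsRegularLocalRing (X.left.presheaf.stalk Q.pt ⧸
      Ideal.span (Set.range fun j ↦ (X.left.presheaf.germ U Q.pt hQU) (g j))))
    (hdim : ringKrullDim (X.left.presheaf.stalk Q.pt ⧸
      Ideal.span (Set.range fun j ↦ (X.left.presheaf.germ U Q.pt hQU) (g j))) + c ≤ n) :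
    Function.Surjective (ContinuousLinearMap.pi fun j ↦
      mfderiv 𝓘(ℂ, E) 𝓘(ℂ, ℂ) (fun m' ↦ evalOrZero U (g j) (φ m')) m) := by
  haveI := hX.smoothOfRelativeDimension
  haveI hregQ : IsRegularLocalRing (X.left.presheaf.stalk Q.pt) :=
    isRegularLocalRing_stalk_of_smoothOfRelativeDimension X.hom n Q.pt
  have hdim' : ringKrullDim (X.left.presheaf.stalk Q.pt ⧸
      Ideal.span (Set.range fun j ↦ (X.left.presheaf.germ U Q.pt hQU) (g j))) + c ≤
      ringKrullDim (X.left.presheaf.stalk Q.pt) := by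
    rw [ringKrullDim_stalk_pt_eq hX Q]
    exact hdim
  exact surjective_pi_mfderiv_evalOrZero_comp hX hφ hU hQ hQU g hg
    (eq_zero_of_sum_smul_mem_ker_sq_of_isRegularLocalRing_quotient Q hQU g hg hreg hdim')

end Transport


/-! ### Bertini twice on a smooth projective surface: a transverse pair of linear forms -/

section Pencil

open Literature.AlgebraicGeometry.Resolution
open Literature.AlgebraicGeometry.Morphisms.ProjCech (grading PP)

attribute [local instance] MvPolynomial.gradedAlgebra
  Literature.AlgebraicGeometry.Motives.ProjBaseChange.algebraBase

variable {X : SchemeOver ℂ} {N : ℕ}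

/-- Membership in a hyperplane section `X ∩ V(Σ aₗ xₗ)` (`LinSec.hyp`) is membership of the
linear form in the homogeneous prime of the image point of `ℙᴺ`. [folklore] -/
theorem LinSec_mem_hyp_iff_linForm_mem (r : X.left ⟶ PP ℂ N) (a : Fin (N + 1) → ℂ) (x : X.left) :
    x ∈ LinSec.hyp r a ↔ LinSec.linForm a ∈ (r.base x).asHomogeneousIdeal :=
  Iff.intro (fun h ↦ not_not.mp h) (fun h ↦ not_not.mpr h)

/-- The generic point of a smooth projective surface has dimension `2` (`dim closure {ξ} = dim X`).
[cite: Hartshorne1977, II Ex. 3.20] -/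
theorem height_genericPoint_eq_two (hX : IsSmoothProjective 2 X) :
    haveI : IsIntegral X.left := IsSmoothProjective.isIntegral_holds hX
    Order.height (genericPoint X.left) = ((2 : ℕ) : ℕ∞) := by
  haveI : IsIntegral X.left := IsSmoothProjective.isIntegral_holds hX
  haveI := hX.smoothOfRelativeDimension
  haveI : LocallyOfFiniteType X.hom := by
    haveI : Smooth X.hom := SmoothOfRelativeDimension.smooth 2 _
    infer_instance
  haveI : Nonempty X.left := ⟨genericPoint X.left⟩
  have h0 : Order.coheight (genericPoint X.left) = 0 :=
    Order.coheight_eq_zero.2 fun y _ ↦ Scheme.le_iff_specializes.2 (genericPoint_specializes y)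
  have h1 := Literature.AlgebraicGeometry.Dimension.coheight_add_height_eq_topologicalKrullDim X.hom
    (genericPoint X.left)
  rw [h0, zero_add, topologicalKrullDim_eq_of_smoothOfRelativeDimension X.hom 2] at h1
  exact WithBot.coe_injective (h1.trans (WithBot.coe_natCast 2).symm)

/-- **Two general hyperplane sections of a smooth projective surface** (Bertini's theorem, twice,
with the dimension count and the projective dimension theorem). For `X` smooth projective of
dimension `2` over `ℂ` with a closed immersion `r : X ↪ ℙᴺ` there are linear forms `t₀, t₁` with:
`t₀` does not vanish identically on `X`; at every closed point `x` of `C = X ∩ V(t₀)` the local ring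
`𝒪_{X,x}/(t₀)` is regular (`C` is a smooth curve); `X ∩ V(t₀, t₁)` has dimension `≤ 0`, at each
of its closed points the two forms generate the maximal ideal `𝔪_x ⊂ 𝒪_{X,x}` (`V(t₁)` meets `C`
transversally), and it has a closed point. Assembled from the tree's iterated Bertini theorem
(`LinSec.isGeneric_bertiniStep`, `LinSec.isRegularLocalRing_cut_of_steps`), the dimension drop
(`LinSec.isGeneric_avoid_genPts`, `LinSec.topologicalKrullDim_cutOf_lt`),
`LinSec.cutIdeal_eq_maximalIdeal`, and the projective dimension theorem
(`exists_specializes_forall_mem`, Hartshorne I 7.2).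
[cite: Hartshorne1977, II Thm. 8.18 and Rem. 8.18.1; I Thm. 7.2] -/
theorem exists_linForms_transverse (hX : IsSmoothProjective 2 X)
    (emb : X ⟶ projectiveSpace N ℂ) [IsClosedImmersion emb.left] :
    haveI : IsIntegral X.left := IsSmoothProjective.isIntegral_holds hX
    ∃ t : Fin 2 → Fin (N + 1) → ℂ,
      genericPoint X.left ∉ LinSec.hyp (emb.left : X.left ⟶ PP ℂ N) (t 0) ∧
      (∀ x : X.left, IsClosed ({x} : Set X.left) → x ∈ LinSec.hyp (emb.left : X.left ⟶ PP ℂ N) (t 0) →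
        IsRegularLocalRing (X.left.presheaf.stalk x ⧸
          LinSec.cutIdeal (emb.left : X.left ⟶ PP ℂ N) x (Fin.take 1 (by omega) t))) ∧
      topologicalKrullDim ↥(LinSec.cutSet (emb.left : X.left ⟶ PP ℂ N) t) ≤ 0 ∧
      (∀ x : X.left, x ∈ LinSec.cutSet (emb.left : X.left ⟶ PP ℂ N) t →
        IsClosed ({x} : Set X.left) ∧
          LinSec.cutIdeal (emb.left : X.left ⟶ PP ℂ N) x t = maximalIdeal (X.left.presheaf.stalk x)) ∧
      (LinSec.cutSet (emb.left : X.left ⟶ PP ℂ N) t).Nonempty := by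
  classical
  haveI : IsIntegral X.left := IsSmoothProjective.isIntegral_holds hX
  set r : X.left ⟶ PP ℂ N := emb.left
  haveI : IsClosedImmersion r := ‹IsClosedImmersion emb.left›
  haveI := hX.smoothOfRelativeDimension
  haveI : LocallyOfFiniteType X.hom := by
    haveI : Smooth X.hom := SmoothOfRelativeDimension.smooth 2 _
    infer_instance
  haveI : IsLocallyNoetherian X.left := LocallyOfFiniteType.isLocallyNoetherian X.hom
  haveI : CompactSpace X.left := IsSmoothProjective.compactSpace_holds hX
  haveI : IsNoetherian X.left := ⟨⟩
  haveI : IsProper X.hom := IsSmoothProjective.isProper_holds hX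
  -- the two generic conditions at each step: avoid the component generic points, and Bertini
  let P : ∀ j : ℕ, (Fin j → Fin (N + 1) → ℂ) → (Fin (N + 1) → ℂ) → Prop := fun j a b ↦
    (∀ w ∈ LinSec.genPts (Set.univ ∩ LinSec.cutSet r a), w ∉ LinSec.hyp r b) ∧ LinSec.BertiniStep r a b
  have hP : ∀ j a, IsGeneric (P j a) := fun j a ↦
    (LinSec.isGeneric_avoid_genPts r _).and (LinSec.isGeneric_bertiniStep r a)
  obtain ⟨t, ht⟩ := exists_seq_of_isGeneric P hP 2
  have havoid : ∀ (j : ℕ) (hj : j < 2), ∀ w ∈ LinSec.genPts (LinSec.cutOf r Set.univ t j hj.le),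
      w ∉ LinSec.hyp r (t ⟨j, hj⟩) := fun j hj ↦ (ht j hj).1
  have hsteps : ∀ (j : ℕ) (hj : j < 2), LinSec.BertiniStep r (Fin.take j hj.le t) (t ⟨j, hj⟩) :=
    fun j hj ↦ (ht j hj).2
  -- dimension count: `dim X = 2`, so `dim X ∩ V(t₀, t₁) ≤ 0`
  have hdimX : topologicalKrullDim (Set.univ : Set X.left) < (2 + 1 : ℕ) := by
    haveI : Nonempty X.left := ⟨genericPoint X.left⟩
    refine (topologicalKrullDim_subspace_le X.left Set.univ).trans_lt ?_
    rw [topologicalKrullDim_eq_of_smoothOfRelativeDimension X.hom 2]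
    exact_mod_cast Nat.lt_succ_self 2
  have hdim0 : topologicalKrullDim ↥(LinSec.cutSet r t) ≤ 0 := by
    have h := LinSec.topologicalKrullDim_cutOf_lt r isClosed_univ t havoid 2 hdimX 2 le_rfl (by omega)
    have e : LinSec.cutOf r Set.univ t 2 le_rfl = LinSec.cutSet r t := by
      rw [LinSec.cutOf, Fin.take_eq_self, Set.univ_inter]
    rw [e] at h
    have h1 : topologicalKrullDim ↥(LinSec.cutSet r t) < 1 := by exact_mod_cast h
    rw [← zero_add (1 : WithBot ℕ∞), ← Nat.cast_zero, ENat.WithBot.lt_add_one_iff] at h1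
    rwa [← Nat.cast_zero]
  -- `t₀` misses the generic point of `X`
  have h0 : (0 : ℕ) < 2 := by omega
  have hξ : genericPoint X.left ∉ LinSec.hyp r (t 0) := by
    have hmem : genericPoint X.left ∈ LinSec.cutOf r Set.univ t 0 h0.le := by
      refine ⟨Set.mem_univ _, ?_⟩
      rw [LinSec.cutSet_zero]
      exact Set.mem_univ _
    obtain ⟨w, hw, hwξ⟩ := LinSec.exists_genPts_specializes (LinSec.isClosed_cutOf r isClosed_univ t 0 h0.le)
      hmem
    have hwξ' : w = genericPoint X.left := (hwξ.antisymm (genericPoint_specializes w)).eq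
    rw [← hwξ']
    exact havoid 0 h0 w hw
  -- regularity along `C = X ∩ V(t₀)` and at the points of `X ∩ V(t₀, t₁)`
  have hsing : ∀ x : X.left, x ∉ LinSec.singSet X.left := fun x h ↦
    h (isRegularLocalRing_stalk_of_smoothOfRelativeDimension X.hom 2 x)
  have hreg1 : ∀ x : X.left, IsClosed ({x} : Set X.left) → x ∈ LinSec.hyp r (t 0) →
      IsRegularLocalRing (X.left.presheaf.stalk x ⧸ LinSec.cutIdeal r x (Fin.take 1 (by omega) t)) := by
    intro x hxc hx
    refine LinSec.isRegularLocalRing_cut_of_steps r t hsteps 1 (by omega) x hxc ?_ (hsing x)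
    rw [LinSec.cutSet_take_succ r t 0 h0, LinSec.cutSet_zero]
    exact ⟨Set.mem_univ _, hx⟩
  have hclosed : ∀ x : X.left, x ∈ LinSec.cutSet r t → IsClosed ({x} : Set X.left) := fun x hx ↦
    Literature.Topology.Set.isClosed_singleton_of_topologicalKrullDim_le_zero (LinSec.isClosed_cutSet r t)
      hdim0 hx
  have hmax : ∀ x : X.left, x ∈ LinSec.cutSet r t →
      LinSec.cutIdeal r x t = maximalIdeal (X.left.presheaf.stalk x) := by
    intro x hx
    have hreg2 := LinSec.isRegularLocalRing_cut_of_steps r t hsteps 2 le_rfl x (hclosed x hx)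
      (by rw [Fin.take_eq_self]; exact hx) (hsing x)
    rw [Fin.take_eq_self] at hreg2
    exact LinSec.cutIdeal_eq_maximalIdeal r x t hreg2 hdim0
  -- `X ∩ V(t₀, t₁) ≠ ∅` by the projective dimension theorem (`dim X = 2`)
  have hne : (LinSec.cutSet r t).Nonempty := by
    have hk : ((2 : ℕ) : ℕ∞) ≤ Order.height (genericPoint X.left) := (height_genericPoint_eq_two hX).ge
    obtain ⟨x', -, hx'⟩ := exists_specializes_forall_mem emb (genericPoint X.left) hk
      (fun i ↦ LinSec.linForm (t i)) fun i ↦ LinSec.linForm_mem (t i)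
    refine ⟨x', Set.mem_iInter.2 fun i ↦ ?_⟩
    exact (LinSec_mem_hyp_iff_linForm_mem r (t i) x').2 (hx' i)
  exact ⟨t, hξ, hreg1, hdim0, fun x hx ↦ ⟨hclosed x hx, hmax x hx⟩, hne⟩

/-! ### `n` general hyperplanes on a smooth projective `n`-fold -/

/-- The generic point of a smooth projective `n`-fold has dimension `n` (`dim closure {ξ} = dim X`).
[cite: Hartshorne1977, II Ex. 3.20] -/
theorem height_genericPoint_eq_natCast {n : ℕ} (hX : IsSmoothProjective n X) :
    haveI : IsIntegral X.left := IsSmoothProjective.isIntegral_holds hX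
    Order.height (genericPoint X.left) = (n : ℕ∞) := by
  haveI : IsIntegral X.left := IsSmoothProjective.isIntegral_holds hX
  haveI := hX.smoothOfRelativeDimension
  haveI : LocallyOfFiniteType X.hom := by
    haveI : Smooth X.hom := SmoothOfRelativeDimension.smooth n _
    infer_instance
  haveI : Nonempty X.left := ⟨genericPoint X.left⟩
  have h0 : Order.coheight (genericPoint X.left) = 0 :=
    Order.coheight_eq_zero.2 fun y _ ↦ Scheme.le_iff_specializes.2 (genericPoint_specializes y)
  have h1 := Literature.AlgebraicGeometry.Dimension.coheight_add_height_eq_topologicalKrullDim X.hom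
    (genericPoint X.left)
  rw [h0, zero_add, topologicalKrullDim_eq_of_smoothOfRelativeDimension X.hom n] at h1
  exact WithBot.coe_injective (h1.trans (WithBot.coe_natCast n).symm)

/-- **`n` general hyperplane sections of a smooth projective `n`-fold** (Bertini's theorem `n`
times, with the dimension count and the projective dimension theorem; the flag
`X ⊃ X ∩ V(t₀) ⊃ X ∩ V(t₀, t₁) ⊃ ⋯` of Serre's / Mumford's induction over hyperplane sections). For
`X` smooth projective of dimension `n` over `ℂ` with a closed immersion `r : X ↪ ℙᴺ` there are
linear forms `t₀, …, t_{n-1}`, none vanishing identically on `X`, such that for every `j ≤ n`, at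
every closed point `x` of `X ∩ V(t₀, …, t_{j-1})`, the local ring `𝒪_{X,x}/(t₀, …, t_{j-1})` is
regular of dimension `≤ n - j` (so `= n - j`: the first `j` forms are part of a regular system of
parameters at `x`), and `X ∩ V(t₀, …, t_{n-1})` is a non-empty finite set of closed points.
Assembled from `LinSec.isGeneric_bertiniStep` / `isRegularLocalRing_cut_of_steps`,
`LinSec.isGeneric_avoid_genPts` / `topologicalKrullDim_cutOf_lt`, `LinSec.isGeneric_notMem_hyp`,
`LinSec.ringKrullDim_quotient_cutIdeal_le` and `exists_specializes_forall_mem` (Hartshorne I 7.2).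
[cite: Hartshorne1977, II Thm. 8.18 and Rem. 8.18.1; I Thm. 7.2] -/
theorem exists_linForms_regularFlag {n : ℕ} (hX : IsSmoothProjective n X)
    (emb : X ⟶ projectiveSpace N ℂ) [IsClosedImmersion emb.left] :
    haveI : IsIntegral X.left := IsSmoothProjective.isIntegral_holds hX
    ∃ t : Fin n → Fin (N + 1) → ℂ,
      (∀ j, genericPoint X.left ∉ LinSec.hyp (emb.left : X.left ⟶ PP ℂ N) (t j)) ∧
      (∀ (j : ℕ) (hj : j ≤ n) (x : X.left), IsClosed ({x} : Set X.left) →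
        x ∈ LinSec.cutSet (emb.left : X.left ⟶ PP ℂ N) (Fin.take j hj t) →
          IsRegularLocalRing (X.left.presheaf.stalk x ⧸
              LinSec.cutIdeal (emb.left : X.left ⟶ PP ℂ N) x (Fin.take j hj t)) ∧
            ringKrullDim (X.left.presheaf.stalk x ⧸
              LinSec.cutIdeal (emb.left : X.left ⟶ PP ℂ N) x (Fin.take j hj t)) + j ≤ n) ∧
      (LinSec.cutSet (emb.left : X.left ⟶ PP ℂ N) t).Finite ∧
      (LinSec.cutSet (emb.left : X.left ⟶ PP ℂ N) t).Nonempty ∧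
      (∀ x ∈ LinSec.cutSet (emb.left : X.left ⟶ PP ℂ N) t, IsClosed ({x} : Set X.left)) := by
  classical
  haveI : IsIntegral X.left := IsSmoothProjective.isIntegral_holds hX
  set r : X.left ⟶ PP ℂ N := emb.left
  haveI : IsClosedImmersion r := ‹IsClosedImmersion emb.left›
  haveI := hX.smoothOfRelativeDimension
  haveI : LocallyOfFiniteType X.hom := by
    haveI : Smooth X.hom := SmoothOfRelativeDimension.smooth n _
    infer_instance
  haveI : IsLocallyNoetherian X.left := LocallyOfFiniteType.isLocallyNoetherian X.hom
  haveI : CompactSpace X.left := IsSmoothProjective.compactSpace_holds hX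
  haveI : IsNoetherian X.left := ⟨⟩
  haveI : IsProper X.hom := IsSmoothProjective.isProper_holds hX
  -- three generic conditions at each step: avoid the component generic points, Bertini, miss `ξ`
  let P : ∀ j : ℕ, (Fin j → Fin (N + 1) → ℂ) → (Fin (N + 1) → ℂ) → Prop := fun j a b ↦
    ((∀ w ∈ LinSec.genPts (Set.univ ∩ LinSec.cutSet r a), w ∉ LinSec.hyp r b) ∧
      LinSec.BertiniStep r a b) ∧ genericPoint X.left ∉ LinSec.hyp r b
  have hP : ∀ j a, IsGeneric (P j a) := fun j a ↦
    ((LinSec.isGeneric_avoid_genPts r _).and (LinSec.isGeneric_bertiniStep r a)).and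
      (LinSec.isGeneric_notMem_hyp r (genericPoint X.left))
  obtain ⟨t, ht⟩ := exists_seq_of_isGeneric P hP n
  have havoid : ∀ (j : ℕ) (hj : j < n), ∀ w ∈ LinSec.genPts (LinSec.cutOf r Set.univ t j hj.le),
      w ∉ LinSec.hyp r (t ⟨j, hj⟩) := fun j hj ↦ (ht j hj).1.1
  have hsteps : ∀ (j : ℕ) (hj : j < n), LinSec.BertiniStep r (Fin.take j hj.le t) (t ⟨j, hj⟩) :=
    fun j hj ↦ (ht j hj).1.2
  have hξ : ∀ j : Fin n, genericPoint X.left ∉ LinSec.hyp r (t j) := fun j ↦ (ht j j.isLt).2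
  -- dimension count: `dim X = n`, so `dim X ∩ V(t₀, …, t_{j-1}) ≤ n - j`
  have hdimX : topologicalKrullDim (Set.univ : Set X.left) < (n + 1 : ℕ) := by
    haveI : Nonempty X.left := ⟨genericPoint X.left⟩
    refine (topologicalKrullDim_subspace_le X.left Set.univ).trans_lt ?_
    rw [topologicalKrullDim_eq_of_smoothOfRelativeDimension X.hom n]
    exact_mod_cast Nat.lt_succ_self n
  have hdimj : ∀ (j : ℕ) (hj : j ≤ n),
      topologicalKrullDim ↥(LinSec.cutSet r (Fin.take j hj t)) < ((n + 1 - j : ℕ) : WithBot ℕ∞) := by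
    intro j hj
    have h := LinSec.topologicalKrullDim_cutOf_lt r isClosed_univ t havoid n hdimX j hj (by omega)
    have e : LinSec.cutOf r Set.univ t j hj = LinSec.cutSet r (Fin.take j hj t) := by
      rw [LinSec.cutOf, Set.univ_inter]
    rwa [e] at h
  have hdim0 : topologicalKrullDim ↥(LinSec.cutSet r t) ≤ 0 := by
    have h := hdimj n le_rfl
    rw [Fin.take_eq_self] at h
    have h1 : topologicalKrullDim ↥(LinSec.cutSet r t) < 1 := by
      have e : n + 1 - n = 1 := by omega
      rw [e] at h
      exact_mod_cast h
    rw [← zero_add (1 : WithBot ℕ∞), ← Nat.cast_zero, ENat.WithBot.lt_add_one_iff] at h1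
    rwa [← Nat.cast_zero]
  -- regularity and dimension of the quotients along the flag
  have hsing : ∀ x : X.left, x ∉ LinSec.singSet X.left := fun x h ↦
    h (isRegularLocalRing_stalk_of_smoothOfRelativeDimension X.hom n x)
  have hflag : ∀ (j : ℕ) (hj : j ≤ n) (x : X.left), IsClosed ({x} : Set X.left) →
      x ∈ LinSec.cutSet r (Fin.take j hj t) →
        IsRegularLocalRing (X.left.presheaf.stalk x ⧸ LinSec.cutIdeal r x (Fin.take j hj t)) ∧
          ringKrullDim (X.left.presheaf.stalk x ⧸ LinSec.cutIdeal r x (Fin.take j hj t)) + j ≤ n := by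
    intro j hj x hxc hx
    have hreg := LinSec.isRegularLocalRing_cut_of_steps r t hsteps j hj x hxc hx (hsing x)
    refine ⟨hreg, ?_⟩
    -- `dim 𝒪/(t) ≤ dim V(t) ≤ n - j`
    haveI : IsLocalRing (X.left.presheaf.stalk x ⧸ LinSec.cutIdeal r x (Fin.take j hj t)) :=
      hreg.toIsLocalRing
    obtain ⟨e, he⟩ := Literature.AlgebraicGeometry.Resolution.ringKrullDim_eq_nat
      (X.left.presheaf.stalk x ⧸ LinSec.cutIdeal r x (Fin.take j hj t))
    have h1 := (LinSec.ringKrullDim_quotient_cutIdeal_le r x (Fin.take j hj t)).trans_lt (hdimj j hj)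
    rw [he] at h1 ⊢
    have h2 : e < n + 1 - j := by exact_mod_cast h1
    have h3 : e + j ≤ n := by omega
    exact_mod_cast h3
  have hclosed : ∀ x : X.left, x ∈ LinSec.cutSet r t → IsClosed ({x} : Set X.left) := fun x hx ↦
    Literature.Topology.Set.isClosed_singleton_of_topologicalKrullDim_le_zero (LinSec.isClosed_cutSet r t)
      hdim0 hx
  have hfin : (LinSec.cutSet r t).Finite :=
    Literature.AlgebraicGeometry.Resolution.set_finite_of_topologicalKrullDim_le_zero _ hdim0
  -- `X ∩ V(t₀, …, t_{n-1}) ≠ ∅` by the projective dimension theorem (`dim X = n`)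
  have hne : (LinSec.cutSet r t).Nonempty := by
    have hk : ((n : ℕ) : ℕ∞) ≤ Order.height (genericPoint X.left) := (height_genericPoint_eq_natCast hX).ge
    obtain ⟨x', -, hx'⟩ := exists_specializes_forall_mem emb (genericPoint X.left) hk
      (fun i ↦ LinSec.linForm (t i)) fun i ↦ LinSec.linForm_mem (t i)
    refine ⟨x', Set.mem_iInter.2 fun i ↦ ?_⟩
    exact (LinSec_mem_hyp_iff_linForm_mem r (t i) x').2 (hx' i)
  exact ⟨t, hξ, hflag, hfin, hne, hclosed⟩

/-! ### The hyperplane-section divisor of a linear form and its two sections `1`, `ℓ'/ℓ` -/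

variable [IsIntegral X.left]

/-- **The hyperplane-section Cartier divisor `H = X ∩ V(ℓ)` of a linear form `ℓ` not vanishing
identically on `X`**, for a morphism `r : X → ℙᴺ` (a closed immersion in the applications):
charts the standard charts `X_h = r⁻¹ D₊(x_h)` meeting `X` (i.e. containing the generic point),
local equations `ℓ/x_h ∈ Γ(X_h, 𝒪_X)` (`LinSec.linSec`), whose quotients `x_{h'}/x_h` are units on
`X_h ∩ X_{h'}` (`LinSec.germ_linSec_eq_mul`, `LinSec.isUnit_germ_coordSec`). This is the effective
Cartier divisor of zeros of the section `ℓ` of `𝒪_X(1) = r^*𝒪(1)` (Hartshorne II.7, p. 157, and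
Prop. 7.7 (a); Görtz–Wedhorn I (13.12), p. 504), with `𝒪_X(H) ≅ 𝒪_X(1)`.
[cite: Hartshorne1977, II.7 (divisor of zeros `(s)₀`) and Prop. 7.7] -/
@[reducible]
def LinSec.hypDivisor (r : X.left ⟶ PP ℂ N) (ℓ : Fin (N + 1) → ℂ)
    (hℓ : genericPoint X.left ∉ LinSec.hyp r ℓ) : CartierDivisor X.left where
  ι := {h : Fin (N + 1) // genericPoint X.left ∈ LinSec.chart r h}
  U h := LinSec.chart r h.1
  covers x := by
    obtain ⟨h, hx⟩ := LinSec.exists_mem_chart r x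
    exact ⟨⟨h, RatFn.genericPoint_mem_of_mem hx⟩, hx⟩
  f h := RatFn.ofSection h.2 (LinSec.linSec r h.1 ℓ)
  f_ne_zero h := ((LinSec.mem_hyp_iff_not_isUnit_germ r h.2 ℓ).not_left.1 hℓ).ne_zero
  isUnitAt_div h h' x hx hx' := by
    have hξ : genericPoint X.left ∈ LinSec.chart r h.1 := h.2
    have hξ' : genericPoint X.left ∈ LinSec.chart r h'.1 := h'.2
    have hne : RatFn.ofSection hξ' (LinSec.linSec r h'.1 ℓ) ≠ 0 :=
      ((LinSec.mem_hyp_iff_not_isUnit_germ r hξ' ℓ).not_left.1 hℓ).ne_zero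
    have e : RatFn.ofSection hξ (LinSec.linSec r h.1 ℓ) / RatFn.ofSection hξ' (LinSec.linSec r h'.1 ℓ) =
        RatFn.ofSection hξ (LinSec.coordSec r h.1 h'.1) := by
      rw [div_eq_iff hne]
      change X.left.presheaf.germ _ _ hξ _ = X.left.presheaf.germ _ _ hξ _ * X.left.presheaf.germ _ _ hξ' _
      exact LinSec.germ_linSec_eq_mul r hξ hξ' ℓ
    rw [e, RatFn.ofSection_eq_toFunctionField hx]
    exact ⟨(LinSec.isUnit_germ_coordSec r hx hx').unit, rfl⟩

/-- The charts of `hypDivisor` (definitional). [folklore] -/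
@[simp]
theorem LinSec.hypDivisor_U (r : X.left ⟶ PP ℂ N) (ℓ : Fin (N + 1) → ℂ)
    (hℓ : genericPoint X.left ∉ LinSec.hyp r ℓ) (h : (LinSec.hypDivisor r ℓ hℓ).ι) :
    (LinSec.hypDivisor r ℓ hℓ).U h = LinSec.chart r h.1 :=
  rfl

/-- The local equations of `hypDivisor` (definitional): the rational function of `ℓ/x_h`.
[folklore] -/
theorem LinSec.hypDivisor_f (r : X.left ⟶ PP ℂ N) (ℓ : Fin (N + 1) → ℂ)
    (hℓ : genericPoint X.left ∉ LinSec.hyp r ℓ) (h : (LinSec.hypDivisor r ℓ hℓ).ι) :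
    (LinSec.hypDivisor r ℓ hℓ).f h = RatFn.ofSection h.2 (LinSec.linSec r h.1 ℓ) :=
  rfl

/-- **`1 ∈ Γ(X, 𝒪_X(H))`**: the hyperplane-section divisor is effective (its local equations
`ℓ/x_h` are regular on the charts). [cite: Hartshorne1977, II Prop. 7.7 (a)] -/
theorem LinSec.hypDivisor_isSection_one (r : X.left ⟶ PP ℂ N) (ℓ : Fin (N + 1) → ℂ)
    (hℓ : genericPoint X.left ∉ LinSec.hyp r ℓ) : (LinSec.hypDivisor r ℓ hℓ).IsSection 1 := by
  intro h x hx
  rw [mul_one]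
  exact RatFn.isRegularAt_ofSection hx _

/-- **The rational function `ℓ'/ℓ ∈ K(X)`** of two linear forms (`ℓ ∉ I(X)`): the quotient of the
sections `ℓ'/x_h`, `ℓ/x_h` on any chart `X_h ≠ ∅` — here the chart of the generic point.
[folklore] -/
def LinSec.ratioFn (r : X.left ⟶ PP ℂ N) (ℓ ℓ' : Fin (N + 1) → ℂ) : X.left.functionField :=
  RatFn.ofSection (LinSec.exists_mem_chart r (genericPoint X.left)).choose_spec
      (LinSec.linSec r (LinSec.exists_mem_chart r (genericPoint X.left)).choose ℓ') /
    RatFn.ofSection (LinSec.exists_mem_chart r (genericPoint X.left)).choose_spec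
      (LinSec.linSec r (LinSec.exists_mem_chart r (genericPoint X.left)).choose ℓ)

/-- **Chart-independence of `ℓ'/ℓ`**: `(ℓ/x_h) · (ℓ'/ℓ) = ℓ'/x_h` in `K(X)` for every chart
`X_h ≠ ∅` (both `ℓ/x_h` and `ℓ'/x_h` transform by the unit `x_{h'}/x_h`). [folklore] -/
theorem LinSec.ofSection_linSec_mul_ratioFn (r : X.left ⟶ PP ℂ N) (ℓ ℓ' : Fin (N + 1) → ℂ)
    (hℓ : genericPoint X.left ∉ LinSec.hyp r ℓ) {h : Fin (N + 1)}
    (hh : genericPoint X.left ∈ LinSec.chart r h) :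
    RatFn.ofSection hh (LinSec.linSec r h ℓ) * LinSec.ratioFn r ℓ ℓ' =
      RatFn.ofSection hh (LinSec.linSec r h ℓ') := by
  set h₀ := (LinSec.exists_mem_chart r (genericPoint X.left)).choose with hh₀def
  have hh₀ : genericPoint X.left ∈ LinSec.chart r h₀ :=
    (LinSec.exists_mem_chart r (genericPoint X.left)).choose_spec
  have hne₀ : RatFn.ofSection hh₀ (LinSec.linSec r h₀ ℓ) ≠ 0 :=
    ((LinSec.mem_hyp_iff_not_isUnit_germ r hh₀ ℓ).not_left.1 hℓ).ne_zero
  have e1 : RatFn.ofSection hh (LinSec.linSec r h ℓ) =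
      RatFn.ofSection hh (LinSec.coordSec r h h₀) * RatFn.ofSection hh₀ (LinSec.linSec r h₀ ℓ) :=
    LinSec.germ_linSec_eq_mul r hh hh₀ ℓ
  have e2 : RatFn.ofSection hh (LinSec.linSec r h ℓ') =
      RatFn.ofSection hh (LinSec.coordSec r h h₀) * RatFn.ofSection hh₀ (LinSec.linSec r h₀ ℓ') :=
    LinSec.germ_linSec_eq_mul r hh hh₀ ℓ'
  change RatFn.ofSection hh (LinSec.linSec r h ℓ) *
      (RatFn.ofSection hh₀ (LinSec.linSec r h₀ ℓ') / RatFn.ofSection hh₀ (LinSec.linSec r h₀ ℓ)) = _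
  rw [e1, e2, mul_assoc, mul_div_cancel₀ _ hne₀]

/-- `ℓ/ℓ = 1` in `K(X)` (for `ℓ ∉ I(X)`). [folklore] -/
theorem LinSec.ratioFn_self (r : X.left ⟶ PP ℂ N) (ℓ : Fin (N + 1) → ℂ)
    (hℓ : genericPoint X.left ∉ LinSec.hyp r ℓ) : LinSec.ratioFn r ℓ ℓ = 1 :=
  div_self ((LinSec.mem_hyp_iff_not_isUnit_germ r
    (LinSec.exists_mem_chart r (genericPoint X.left)).choose_spec ℓ).not_left.1 hℓ).ne_zero

/-- **`ℓ'/ℓ ∈ Γ(X, 𝒪_X(H))`** for `H = X ∩ V(ℓ)`: on the chart `X_h` one has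
`(ℓ/x_h)(ℓ'/ℓ) = ℓ'/x_h`, regular. Under `𝒪_X(H) ≅ 𝒪_X(1)` this is the section `ℓ'`.
[cite: Hartshorne1977, II.7 (p. 157) and Prop. 7.7] -/
theorem LinSec.hypDivisor_isSection_ratioFn (r : X.left ⟶ PP ℂ N) (ℓ ℓ' : Fin (N + 1) → ℂ)
    (hℓ : genericPoint X.left ∉ LinSec.hyp r ℓ) :
    (LinSec.hypDivisor r ℓ hℓ).IsSection (LinSec.ratioFn r ℓ ℓ') := by
  intro h x hx
  rw [LinSec.hypDivisor_f, LinSec.ofSection_linSec_mul_ratioFn r ℓ ℓ' hℓ h.2]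
  exact RatFn.isRegularAt_ofSection hx _

/-! ### The coordinates of the sections `1` and `ℓ'/ℓ` on an analytification -/

/-- The section of the rational function of a section is that section. [folklore] -/
theorem RatFn_sectionOf_ofSection {U : X.left.Opens} (hU : genericPoint X.left ∈ U)
    (σ : Γ(X.left, U)) (hh : ∀ y ∈ U, RatFn.IsRegularAt y (RatFn.ofSection hU σ)) :
    RatFn.sectionOf hU (RatFn.ofSection hU σ) hh = σ :=
  RatFn.section_ext fun _ ↦ RatFn.ofSection_sectionOf _ _ _

variable {M : Type} (φ : M → ComplexPoints X)

/-- **The coordinate of the section `1` of `𝒪_X(H)` in the frame over `φ⁻¹(X_h(ℂ))` is the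
function `m ↦ (ℓ/x_h)(φ m)`.** [cite: GortzWedhorn2020, Section (11.9) (p. 374)] -/
theorem LinSec.sectionCoord_hypDivisor_one (r : X.left ⟶ PP ℂ N) (ℓ : Fin (N + 1) → ℂ)
    (hℓ : genericPoint X.left ∉ LinSec.hyp r ℓ) (h : (LinSec.hypDivisor r ℓ hℓ).ι) :
    (LinSec.hypDivisor r ℓ hℓ).sectionCoord φ (LinSec.hypDivisor_isSection_one r ℓ hℓ) h =
      fun m ↦ evalOrZero (LinSec.chart r h.1) (LinSec.linSec r h.1 ℓ) (φ m) := by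
  funext m
  have hξ : genericPoint X.left ∈ (LinSec.hypDivisor r ℓ hℓ).U h := h.2
  simp only [CartierDivisor.sectionCoord, dif_pos hξ]
  change evalOrZero (LinSec.chart r h.1) _ (φ m) = _
  congr 1
  refine RatFn.section_ext fun hU ↦ ?_
  rw [RatFn.ofSection_sectionOf, mul_one]

/-- **The coordinate of the section `ℓ'/ℓ` of `𝒪_X(H)` in the frame over `φ⁻¹(X_h(ℂ))` is the
function `m ↦ (ℓ'/x_h)(φ m)`.** [cite: GortzWedhorn2020, Section (11.9) (p. 374)] -/
theorem LinSec.sectionCoord_hypDivisor_ratioFn (r : X.left ⟶ PP ℂ N) (ℓ ℓ' : Fin (N + 1) → ℂ)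
    (hℓ : genericPoint X.left ∉ LinSec.hyp r ℓ) (h : (LinSec.hypDivisor r ℓ hℓ).ι) :
    (LinSec.hypDivisor r ℓ hℓ).sectionCoord φ (LinSec.hypDivisor_isSection_ratioFn r ℓ ℓ' hℓ) h =
      fun m ↦ evalOrZero (LinSec.chart r h.1) (LinSec.linSec r h.1 ℓ') (φ m) := by
  funext m
  have hξ : genericPoint X.left ∈ (LinSec.hypDivisor r ℓ hℓ).U h := h.2
  simp only [CartierDivisor.sectionCoord, dif_pos hξ]
  change evalOrZero (LinSec.chart r h.1) _ (φ m) = _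
  congr 1
  refine RatFn.section_ext fun hU ↦ ?_
  rw [RatFn.ofSection_sectionOf]
  exact LinSec.ofSection_linSec_mul_ratioFn r ℓ ℓ' hℓ hU

omit [IsIntegral X.left] in
/-- On a chart `X_h`, a point lies on `V(ℓ)` iff the value of `ℓ/x_h` at the complex point is `0`.
[folklore] -/
theorem LinSec.pt_mem_hyp_iff_eval_eq_zero (r : X.left ⟶ PP ℂ N) (ℓ : Fin (N + 1) → ℂ)
    (P : ComplexPoints X) {h : Fin (N + 1)} (hP : P.pt ∈ LinSec.chart r h) :
    P.pt ∈ LinSec.hyp r ℓ ↔ P.eval (LinSec.chart r h) hP (LinSec.linSec r h ℓ) = 0 := by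
  rw [LinSec.mem_hyp_iff_not_isUnit_germ r hP, ← Scheme.mem_basicOpen,
    AlgPoints.pt_mem_basicOpen_iff P hP, not_not]

end Pencil

/-! ### Assembly: the transverse pencil read on the analytification -/

section Assembly

open Literature.AlgebraicGeometry.Resolution
open Literature.AlgebraicGeometry.Morphisms.ProjCech (grading PP)

attribute [local instance] MvPolynomial.gradedAlgebra
  Literature.AlgebraicGeometry.Motives.ProjBaseChange.algebraBase

variable {X : SchemeOver ℂ}

/-- **A transverse pencil of hyperplane sections of a smooth projective surface, on the
analytification.** Let `X` be smooth projective of dimension `2` over `ℂ` and `φ : M → X(ℂ)` an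
analytification with a holomorphic atlas on `M`. There are a Cartier divisor `H` on `X` — the
hyperplane section `X ∩ V(ℓ)` of a general linear form for a projective embedding — carrying the
global sections `1` and `s = ℓ'/ℓ` of `𝒪_X(H)` (`ℓ'` a second general form), such that the
holomorphic coordinates `t_a = (f_a · 1) ∘ φ`, `t'_a = (f_a · s) ∘ φ` of these sections in the
frames of `𝒪_X(H)^an` over `φ⁻¹(U_a(ℂ))` (`CartierDivisor.sectionCoord`; they are the functions
`(ℓ/x_a) ∘ φ`, `(ℓ'/x_a) ∘ φ`) satisfy: (1) `dt_a(m) ≠ 0` wherever `t_a(m) = 0` — the hyperplane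
section `C = {t = 0} ⊂ M` is a smooth curve with reduced equation `t`; (2) wherever
`t_a(m) = t'_a(m) = 0`, the pair `(dt_a(m), dt'_a(m)) : T_m M → ℂ²` is onto — `V(ℓ')` meets `C`
transversally, `t_a, t'_a` are local holomorphic coordinates there; (3) there is such a common zero.
(1)–(2) are Bertini's theorem (Hartshorne II 8.18) applied twice on `X` together with Serre's
transport of simple points to the analytification (GAGA §2 n° 6 Cor. 2); (3) is the projective
dimension theorem (Hartshorne I 7.2). This is the geometric input `C`, `C ∩ C'` of the dimension
count in Serre's proof of Théorème A for line bundles on a surface (FAC n° 81; GAGA n° 16 Lemme 8).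
[cite: Hartshorne1977, II Thm. 8.18 and I Thm. 7.2] [cite: SerreGAGA1956, §2 n°6 Cor. 2 and n° 16 Lemme 8] -/
theorem exists_transverse_pencil (hX : IsSmoothProjective 2 X) [IsIntegral X.left]
    {E : Type} [NormedAddCommGroup E] [NormedSpace ℂ E] [FiniteDimensional ℂ E]
    {M : Type} [TopologicalSpace M] [ChartedSpace E M] [IsManifold 𝓘(ℂ, E) ω M]
    {φ : M → ComplexPoints X} (hφ : IsAnalytification E X 2 φ) :
    ∃ (H : CartierDivisor X.left) (s : X.left.functionField) (h1 : H.IsSection 1) (hs : H.IsSection s),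
      (∀ (a : H.ι) (m : M), (φ m).pt ∈ H.U a → H.sectionCoord φ h1 a m = 0 →
        mfderiv 𝓘(ℂ, E) 𝓘(ℂ, ℂ) (H.sectionCoord φ h1 a) m ≠ 0) ∧
      (∀ (a : H.ι) (m : M), (φ m).pt ∈ H.U a → H.sectionCoord φ h1 a m = 0 →
        H.sectionCoord φ hs a m = 0 →
          Function.Surjective (ContinuousLinearMap.pi fun j : Fin 2 ↦
            mfderiv 𝓘(ℂ, E) 𝓘(ℂ, ℂ) (![H.sectionCoord φ h1 a, H.sectionCoord φ hs a] j) m)) ∧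
      (∃ (a : H.ι) (m : M), (φ m).pt ∈ H.U a ∧ H.sectionCoord φ h1 a m = 0 ∧
        H.sectionCoord φ hs a m = 0) := by
  classical
  haveI := hX.smoothOfRelativeDimension
  haveI : LocallyOfFiniteType X.hom := by
    haveI : Smooth X.hom := SmoothOfRelativeDimension.smooth 2 _
    infer_instance
  -- a projective embedding and a transverse pair of linear forms
  obtain ⟨N, emb, hemb⟩ := hX.isProjectiveOver
  haveI : IsClosedImmersion emb.left := hemb
  obtain ⟨t, hξ, hreg1, hdim0, hmax, hne⟩ := exists_linForms_transverse hX emb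
  set r : X.left ⟶ PP ℂ N := emb.left
  haveI : IsClosedImmersion r := hemb
  let H := LinSec.hypDivisor r (t 0) hξ
  have h1 : H.IsSection 1 := LinSec.hypDivisor_isSection_one r (t 0) hξ
  have hs : H.IsSection (LinSec.ratioFn r (t 0) (t 1)) := LinSec.hypDivisor_isSection_ratioFn r (t 0) (t 1) hξ
  have hc1 : ∀ a : H.ι, H.sectionCoord φ h1 a =
      fun m ↦ evalOrZero (LinSec.chart r a.1) (LinSec.linSec r a.1 (t 0)) (φ m) :=
    LinSec.sectionCoord_hypDivisor_one φ r (t 0) hξ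
  have hcs : ∀ a : H.ι, H.sectionCoord φ hs a =
      fun m ↦ evalOrZero (LinSec.chart r a.1) (LinSec.linSec r a.1 (t 1)) (φ m) :=
    LinSec.sectionCoord_hypDivisor_ratioFn φ r (t 0) (t 1) hξ
  -- reading `t_a(m) = 0`: the point `φ m` lies on `V(t₀)`
  have hzero : ∀ (a : H.ι) (m : M) (hm : (φ m).pt ∈ LinSec.chart r a.1) (i : Fin 2),
      evalOrZero (LinSec.chart r a.1) (LinSec.linSec r a.1 (t i)) (φ m) = 0 ↔
        (φ m).pt ∈ LinSec.hyp r (t i) := fun a m hm i ↦ by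
    rw [evalOrZero_of_mem _ hm, LinSec.pt_mem_hyp_iff_eval_eq_zero r (t i) (φ m) hm]
  refine ⟨H, LinSec.ratioFn r (t 0) (t 1), h1, hs, ?_, ?_, ?_⟩
  · -- (1) `dt ≠ 0` along `C`
    intro a m hm0 ht0
    have hm : (φ m).pt ∈ LinSec.chart r a.1 := hm0
    rw [hc1 a] at ht0 ⊢
    have hmem : (φ m).pt ∈ LinSec.hyp r (t 0) := (hzero a m hm 0).1 ht0
    have hev : (φ m).eval (LinSec.chart r a.1) hm (LinSec.linSec r a.1 (t 0)) = 0 := by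
      rw [← evalOrZero_of_mem _ hm]; exact ht0
    have hreg := hreg1 (φ m).pt (ComplexPoints.isClosed_pt (φ m)) hmem
    rw [LinSec.cutIdeal_eq_span_of_mem r (φ m).pt _ hm] at hreg
    have hrange : (Set.range fun i : Fin 1 ↦ X.left.presheaf.germ (LinSec.chart r a.1) (φ m).pt hm
        (LinSec.linSec r a.1 (Fin.take 1 (by omega) t i))) =
        {X.left.presheaf.germ (LinSec.chart r a.1) (φ m).pt hm (LinSec.linSec r a.1 (t 0))} := by
      ext g
      simp only [Set.mem_range, Set.mem_singleton_iff]
      constructor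
      · rintro ⟨i, rfl⟩
        rw [Subsingleton.elim i 0]
        rfl
      · rintro rfl
        exact ⟨0, rfl⟩
    rw [hrange] at hreg
    have hg0 : X.left.presheaf.germ (LinSec.chart r a.1) (φ m).pt hm (LinSec.linSec r a.1 (t 0)) ≠ 0 := by
      intro h0
      apply H.f_ne_zero a
      show RatFn.ofSection _ (LinSec.linSec r a.1 (t 0)) = 0
      exact (RatFn.ofSection_eq_toFunctionField hm _).trans (by rw [h0, map_zero])
    exact mfderiv_evalOrZero_comp_ne_zero_of_isRegularLocalRing_quotient hX hφ
      (LinSec.isAffineOpen_chart r a.1) rfl hm (LinSec.linSec r a.1 (t 0)) hev hg0 hreg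
  · -- (2) `(dt, dt')` onto at the points of `C ∩ C'`
    intro a m hm0 ht0 ht1
    have hm : (φ m).pt ∈ LinSec.chart r a.1 := hm0
    rw [hc1 a] at ht0
    rw [hcs a] at ht1
    have hmem : (φ m).pt ∈ LinSec.cutSet r t := by
      refine Set.mem_iInter.2 fun i ↦ ?_
      fin_cases i
      · exact (hzero a m hm 0).1 ht0
      · exact (hzero a m hm 1).1 ht1
    have hev : ∀ j : Fin 2, (φ m).eval (LinSec.chart r a.1) hm (LinSec.linSec r a.1 (t j)) = 0 := by
      intro j
      rw [← evalOrZero_of_mem _ hm]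
      fin_cases j
      · exact ht0
      · exact ht1
    have hspan := (hmax (φ m).pt hmem).2
    rw [LinSec.cutIdeal_eq_span_of_mem r (φ m).pt t hm] at hspan
    have hsurj := surjective_pi_mfderiv_evalOrZero_comp_of_span_eq_maximalIdeal hX hφ
      (LinSec.isAffineOpen_chart r a.1) rfl hm (fun j ↦ LinSec.linSec r a.1 (t j)) hev hspan
    have e : (![H.sectionCoord φ h1 a, H.sectionCoord φ hs a] : Fin 2 → M → ℂ) =
        fun j m' ↦ evalOrZero (LinSec.chart r a.1) (LinSec.linSec r a.1 (t j)) (φ m') := by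
      funext j
      fin_cases j
      · show H.sectionCoord φ h1 a = _
        rw [hc1 a]
        rfl
      · show H.sectionCoord φ hs a = _
        rw [hcs a]
        rfl
    rw [e]
    exact hsurj
  · -- (3) a common zero
    obtain ⟨x, hx⟩ := hne
    have hxc : IsClosed ({x} : Set X.left) := (hmax x hx).1
    obtain ⟨P, hP⟩ := AlgPoints.exists_pt_eq_of_isClosed (L := ℂ) x hxc
    obtain ⟨m, hm⟩ := hφ.isHomeomorph.surjective P
    obtain ⟨h, hxh⟩ := LinSec.exists_mem_chart r x
    have hmh : (φ m).pt ∈ LinSec.chart r h := by rw [hm, hP]; exact hxh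
    refine ⟨⟨h, RatFn.genericPoint_mem_of_mem hxh⟩, m, hmh, ?_, ?_⟩
    · rw [hc1]
      refine (hzero ⟨h, RatFn.genericPoint_mem_of_mem hxh⟩ m hmh 0).2 ?_
      rw [hm, hP]
      exact Set.mem_iInter.1 hx 0
    · rw [hcs]
      refine (hzero ⟨h, RatFn.genericPoint_mem_of_mem hxh⟩ m hmh 1).2 ?_
      rw [hm, hP]
      exact Set.mem_iInter.1 hx 1

/-- **`n` general hyperplane sections of a smooth projective `n`-fold, on the analytification**
(the flag of Serre's / Mumford's induction over hyperplane sections, FAC n° 81, GAGA n° 16,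
*Abelian Varieties* §16, read on `X^an`). Let `X` be smooth projective of dimension `n ≥ 1` over
`ℂ` and `φ : M → X(ℂ)` an analytification with a holomorphic atlas. There are a Cartier divisor
`H` on `X` (the hyperplane section `X ∩ V(t₀)` of a general linear form for a projective embedding)
and global sections `s₀ = 1, s₁ = t₁/t₀, …, s_{n-1} = t_{n-1}/t₀` of `𝒪_X(H)` (general forms
`tⱼ`) whose holomorphic coordinates `u_{j,a} = (f_a sⱼ) ∘ φ = (tⱼ/x_a) ∘ φ` in the frames of
`𝒪_X(H)^an` (`CartierDivisor.sectionCoord`) satisfy: **for every `j ≤ n`, at every point `m` where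
`u_{0,a}, …, u_{j-1,a}` vanish, their differentials are jointly onto `ℂʲ`** (they are part of a
holomorphic coordinate system at `m`: `j = 1` says the hyperplane section `{u₀ = 0}` is a smooth
hypersurface with reduced equation `u₀`; in general `V(tⱼ)` cuts `{u₀ = ⋯ = u_{j-1} = 0}`
transversally); the common zero set of all `n` coordinates is **finite and non-empty**; and each
`{uⱼ ≠ 0}` is **dense** in `M` (`tⱼ ∉ I(X)`; Serre, GAGA Prop. 5). Bertini (Hartshorne II 8.18)
`n` times with Serre's transport of simple points (GAGA §2 n° 6 Cor. 2), the projective dimension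
theorem (Hartshorne I 7.2), and `X(ℂ) ↔` closed points (Nullstellensatz).
[cite: Hartshorne1977, II Thm. 8.18 and I Thm. 7.2] [cite: SerreGAGA1956, §2 n°6 Cor. 2, n°7 Prop. 5 and n° 16 Lemme 8] -/
theorem exists_transverse_flag {n : ℕ} (hX : IsSmoothProjective n X) [IsIntegral X.left] (hn : 0 < n)
    {E : Type} [NormedAddCommGroup E] [NormedSpace ℂ E] [FiniteDimensional ℂ E]
    {M : Type} [TopologicalSpace M] [ChartedSpace E M] [IsManifold 𝓘(ℂ, E) ω M]
    {φ : M → ComplexPoints X} (hφ : IsAnalytification E X n φ) :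
    ∃ (H : CartierDivisor X.left) (s : Fin n → X.left.functionField) (hs : ∀ j, H.IsSection (s j)),
      s ⟨0, hn⟩ = 1 ∧
      (∀ (a : H.ι) (m : M) (j : ℕ) (hj : j ≤ n), (φ m).pt ∈ H.U a →
        (∀ i : Fin j, H.sectionCoord φ (hs (Fin.castLE hj i)) a m = 0) →
          Function.Surjective (ContinuousLinearMap.pi fun i : Fin j ↦
            mfderiv 𝓘(ℂ, E) 𝓘(ℂ, ℂ) (H.sectionCoord φ (hs (Fin.castLE hj i)) a) m)) ∧
      {m : M | ∃ a : H.ι, (φ m).pt ∈ H.U a ∧ ∀ j, H.sectionCoord φ (hs j) a m = 0}.Finite ∧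
      {m : M | ∃ a : H.ι, (φ m).pt ∈ H.U a ∧ ∀ j, H.sectionCoord φ (hs j) a m = 0}.Nonempty ∧
      (∀ j, Dense {m : M | ∀ a : H.ι, (φ m).pt ∈ H.U a → H.sectionCoord φ (hs j) a m ≠ 0}) := by
  classical
  haveI := hX.smoothOfRelativeDimension
  haveI : LocallyOfFiniteType X.hom := by
    haveI : Smooth X.hom := SmoothOfRelativeDimension.smooth n _
    infer_instance
  -- a projective embedding and `n` general linear forms
  obtain ⟨N, emb, hemb⟩ := hX.isProjectiveOver
  haveI : IsClosedImmersion emb.left := hemb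
  obtain ⟨t, hξ, hflag, hfin, hne, hclosed⟩ := exists_linForms_regularFlag hX emb
  set r : X.left ⟶ PP ℂ N := emb.left
  haveI : IsClosedImmersion r := hemb
  let H := LinSec.hypDivisor r (t ⟨0, hn⟩) (hξ ⟨0, hn⟩)
  let s : Fin n → X.left.functionField := fun j ↦ LinSec.ratioFn r (t ⟨0, hn⟩) (t j)
  have hs : ∀ j, H.IsSection (s j) := fun j ↦
    LinSec.hypDivisor_isSection_ratioFn r (t ⟨0, hn⟩) (t j) (hξ ⟨0, hn⟩)
  have hcs : ∀ (j : Fin n) (a : H.ι), H.sectionCoord φ (hs j) a =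
      fun m ↦ evalOrZero (LinSec.chart r a.1) (LinSec.linSec r a.1 (t j)) (φ m) := fun j a ↦
    LinSec.sectionCoord_hypDivisor_ratioFn φ r (t ⟨0, hn⟩) (t j) (hξ ⟨0, hn⟩) a
  -- reading `u_{j,a}(m) = 0`: the point `φ m` lies on `V(tⱼ)`
  have hzero : ∀ (a : H.ι) (m : M) (hm : (φ m).pt ∈ LinSec.chart r a.1) (j : Fin n),
      H.sectionCoord φ (hs j) a m = 0 ↔ (φ m).pt ∈ LinSec.hyp r (t j) := fun a m hm j ↦ by
    rw [hcs j a]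
    change evalOrZero _ _ (φ m) = 0 ↔ _
    rw [evalOrZero_of_mem _ hm, LinSec.pt_mem_hyp_iff_eval_eq_zero r (t j) (φ m) hm]
  refine ⟨H, s, hs, LinSec.ratioFn_self r _ (hξ ⟨0, hn⟩), ?_, ?_, ?_, ?_⟩
  · -- transversality along the flag
    intro a m j hj hm0 hvan
    have hm : (φ m).pt ∈ LinSec.chart r a.1 := hm0
    have hmem : (φ m).pt ∈ LinSec.cutSet r (Fin.take j hj t) := by
      refine Set.mem_iInter.2 fun i ↦ ?_
      rw [Fin.take_apply]
      exact (hzero a m hm _).1 (hvan i)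
    obtain ⟨hreg, hdim⟩ := hflag j hj (φ m).pt (ComplexPoints.isClosed_pt (φ m)) hmem
    rw [LinSec.cutIdeal_eq_span_of_mem r (φ m).pt (Fin.take j hj t) hm] at hreg hdim
    have hev : ∀ i : Fin j, (φ m).eval (LinSec.chart r a.1) hm
        (LinSec.linSec r a.1 (Fin.take j hj t i)) = 0 := by
      intro i
      rw [Fin.take_apply, ← LinSec.pt_mem_hyp_iff_eval_eq_zero r _ (φ m) hm]
      exact (hzero a m hm _).1 (hvan i)
    have hsurj := surjective_pi_mfderiv_evalOrZero_comp_of_isRegularLocalRing_quotient hX hφ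
      (LinSec.isAffineOpen_chart r a.1) rfl hm (fun i ↦ LinSec.linSec r a.1 (Fin.take j hj t i))
      hev hreg hdim
    have e : (fun i : Fin j ↦ H.sectionCoord φ (hs (Fin.castLE hj i)) a) =
        fun i m' ↦ evalOrZero (LinSec.chart r a.1) (LinSec.linSec r a.1 (Fin.take j hj t i)) (φ m') := by
      funext i
      rw [hcs, Fin.take_apply]
    have key : ∀ F G : Fin j → M → ℂ, F = G →
        Function.Surjective (ContinuousLinearMap.pi fun i : Fin j ↦ mfderiv 𝓘(ℂ, E) 𝓘(ℂ, ℂ) (G i) m) →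
        Function.Surjective (ContinuousLinearMap.pi fun i : Fin j ↦ mfderiv 𝓘(ℂ, E) 𝓘(ℂ, ℂ) (F i) m) := by
      rintro F G rfl h
      exact h
    exact key _ _ e hsurj
  · -- finiteness of the common zero set: `φ⁻¹` of the complex points over the finite `X ∩ V(t)`
    have hsub : {m : M | ∃ a : H.ι, (φ m).pt ∈ H.U a ∧ ∀ j, H.sectionCoord φ (hs j) a m = 0} ⊆
        φ ⁻¹' {P : ComplexPoints X | P.pt ∈ LinSec.cutSet r t} := by
      rintro m ⟨a, ha, hz⟩
      exact Set.mem_iInter.2 fun j ↦ (hzero a m ha j).1 (hz j)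
    refine Set.Finite.subset ?_ hsub
    refine Set.Finite.preimage (hφ.isHomeomorph.injective.injOn) ?_
    refine hfin.preimage fun P _ P' _ hPP' ↦ ?_
    exact (ComplexPoints.equivClosedPoints X).injective (Subtype.ext hPP')
  · -- a common zero
    obtain ⟨x, hx⟩ := hne
    obtain ⟨P, hP⟩ := AlgPoints.exists_pt_eq_of_isClosed (L := ℂ) x (hclosed x hx)
    obtain ⟨m, hm⟩ := hφ.isHomeomorph.surjective P
    obtain ⟨h, hxh⟩ := LinSec.exists_mem_chart r x
    have hmh : (φ m).pt ∈ LinSec.chart r h := by rw [hm, hP]; exact hxh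
    refine ⟨m, ⟨h, RatFn.genericPoint_mem_of_mem hxh⟩, hmh, fun j ↦ ?_⟩
    refine (hzero ⟨h, RatFn.genericPoint_mem_of_mem hxh⟩ m hmh j).2 ?_
    rw [hm, hP]
    exact Set.mem_iInter.1 hx j
  · -- density of `{uⱼ ≠ 0} = φ⁻¹(X_{tⱼ}(ℂ))` (GAGA Prop. 5)
    intro j
    have hdense : Dense ((LinSec.XL r (t j) : X.left.Opens) : Set X.left) := by
      refine (LinSec.XL r (t j)).isOpen.dense ⟨genericPoint X.left, ?_⟩
      exact not_not.1 (hξ j)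
    have hD := ComplexPoints.dense_setOf_pt_mem X (ComplexPoints.closure_setOf_pt_mem_holds (X := X))
      (LinSec.XL r (t j)) hdense
    refine (hD.preimage hφ.isHomeomorph.isOpenMap).mono ?_
    intro m hm a ha h0
    have hmem : (φ m).pt ∈ LinSec.hyp r (t j) := (hzero a m ha j).1 h0
    exact hmem hm

end Assembly



end Literature.AlgebraicGeometry.HodgeTheory

end
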